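import Literature.Probability.RandomPlanarGeometry.HexSAWBrickWallStripFugacityWidthOneContactLDP
import HarnessLib

/-!
# Large deviations of the rung density of the strip self-avoiding walk under every two-wall measure `P_{N,y,z}`

The file `HexSAWBrickWallStripFugacityWidthOneContactLDP.lean` (§16–§18) proved the large deviation principle of the total
surface-contact fraction `(bc+tc)/N` and — through the parity identity `2(bc+tc) + V = N + O(1)` (`two_mul_totalVisits_add_nV`) — of the
RUNG DENSITY `V(ω)/N` on the DIAGONAL `y = z` (both walls equally attractive; in particular the uniform measure).  THIS FILE removes
the restriction to the diagonal: for EVERY pair of fugacities `y, z > 0` the natural tilts are the RAYS `u ↦ (yu, zu)` (the weight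
`u^{bc+tc}` multiplies both fugacities), and the one missing ingredient off the diagonal is the STRICT MONOTONICITY of the total
contact density `t(yu,zu) = b(yu,zu) + b(zu,yu)` along the ray.  We prove it algebraically (§1): with `σ = μ_1(yu,zu)²/u` the sextic law
becomes `σ(σ−y)(σ−z) = yz/u` (so `σ` decreases along the ray) and `t = σ(2σ−y−z)/(2(3σ²−2(y+z)σ+yz))` is strictly decreasing in `σ`
on `(max(y,z),∞)` — `T(a) − T(b)` has the sign of `(b−a)·[(y+z)ab + (y+z)yz − 2yz(a+b)]`, a positive bracket.

## Main statements (namespace `Literature.Probability.RandomPlanarGeometry.SAW.HexBW`, all PROVED, standard axioms)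

§1 `totalDensity_eq` (`t = s(2s−y−z)/(2F(s))`), ★★ `scaledTotal_strictAnti` (the algebraic heart), `cubic_mono`,
★★ **`totalDensity_ray_strictMono`** (`u < u' ⇒ t(yu,zu) < t(yu',zu')`).
§2 `log_stripMuY₂_ray_sub_mem` (four one-variable tangent bounds along a ray), ★★ **`hasDerivAt_log_stripMuY₂_ray_exp`**
(`d/dτ log μ_1(yeᵗ,zeᵗ) = t(yeᵗ,zeᵗ)`: squeeze + joint continuity of `b`), ★★ `total_mul_log_lt_log_stripMuY₂_ray_sub` (STRICT tangent
inequality along rays, mean value theorem), ★ `rayRate y z u = I_ray(y,z;u) = t(yu,zu) log u − log(μ_1(yu,zu)/μ_1(y,z))`, `rayRate_one`,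
★★ `rayRate_pos` (`u ≠ 1`), `rayRate_self` (`= diagRate y (yu)` on the diagonal).
§3 `continuousAt_windowCostRay`, ★★★ **`totalContactsRay_ge_exp_bounds`** / **`totalContactsRay_le_exp_bounds`** (two-sided exponential
bounds for `P_{N,y,z}(bc+tc ≥ t(yu,zu)N + d)`, `u ≥ 1`, resp. `≤`, `u ≤ 1`, ANY real shift `d` — the tree's ray machinery
`exp_le_windowFractionT`, `fraction_le_exp_of_chernoff₂` of the previous file with the new strict monotonicity),
★★★ **`tendsto_log_totalContactsRay_ge_le_div`** (the LDP of the total surface-contact fraction under every `P_{N,y,z}`).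
§4 `two_mul_totalDensity` (`2t(Y,Z) = 1 − ρ(Y,Z)`, `ρ = HexBW.twoWallRho`), `rung_event_sandwich₂`, ★★★ **`tendsto_log_rungsRay_div`**:
for all `y, z > 0`: `u ≥ 1 ⇒ (1/N) log P_{N,y,z}(V(ω) ≤ ρ(yu,zu)·N) → −I_ray(y,z;u)`; `0 < u ≤ 1 ⇒ (1/N) log P_{N,y,z}(V(ω) ≥ ρ(yu,zu)·N) →
−I_ray(y,z;u)` — the large deviations behind the tree's two-wall rung law `tendsto_twoWallRungDevFraction` (`V/N → ρ(y,z)`).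
§5 (ed.2) `totalDensity_ray_eq_scaled` (t through `σ = μ_1(yu,zu)²/u`), ★★ **`twoWallRho_lt_one_third`** (the typical rung density of EVERY
two-wall measure is `< 1/3`: `(y+z)σ > 2yz`), `tendsto_scaledSigma_nhdsGT_zero` (`σ_u → ∞` as `u → 0⁺`), ★★ **`tendsto_twoWallRho_ray_nhdsGT_zero`**
(`t(yu,zu) → 1/3` and `ρ(yu,zu) → 1/3` as `u → 0⁺`: infinitely repelling walls force a rung at every third step — the bound `1/3` is sharp),
★★ `twoWallSpeed_ray` (the two-wall SPEED `v(yu,zu)` is strictly increasing along rays and `→ 2/3` as `u → 0⁺`: the lower bound `2/3 < v` of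
#555 ed.5 `twoWallSpeed_mem_Ioo` is sharp).

## Sources and method

Method: Cramér along rays (DemboZeitouni2010 §2.2 Thm 2.2.3: Chebycheff upper bound with the exact tilt, change of measure to a
nearby ray point + the tree's two laws of large numbers for the lower bound); framework JansevanRensburg2000 §3.2 Thms 3.17–3.19
(integrated density functions; Oxford Lecture Series 18, OUP 2000 — the held edition, whose numbering is used); objects BBdGDCG2014 §3.2 p. 10 (`C_{T,N}(y,z)`, Proposition 6), MadrasSlade1993 §1.1 (1.1.5), §8.5;
EntingJensen2009 §7.4.2 Fig. 7.10 (brick-wall bonds, lane plumbing).  No quotation AS PRINTED; no source in our holdings states the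
rate function or the ray monotonicity — both are this lineage's.  NOT CLAIMED: tilts off the rays (the joint `(bc,tc)` LDP in the
aligned quadrants), the span `|X(ω)|/N`, an explicit inverse `u(ρ)` off the diagonal (the sextic does not factor there).
-/

noncomputable section

open Filter Topology Finset Literature.Probability.LatticeModels Literature.Probability.Percolation SimpleGraph

namespace Literature.Probability.RandomPlanarGeometry.SAW.HexBW

open WidthOneYZ

variable {y z : ℝ}

/-! ## §1 The total surface-contact density `t(y,z) = b(y,z) + b(z,y)` is STRICTLY increasing along every ray `u ↦ (yu, zu)` -/

/-- The total surface-contact density `t(y,z) = b(y,z) + b(z,y) = s(2s − y − z)/(2F(s))`, `s = μ_1(y,z)²`, `F(s) = 3s² − 2(y+z)s + yz`.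
[cite: BeatonBousquetMelouDeGierDuminilCopinGuttmann2014, §3.2 Proposition 6 (arXiv v5 p. 10)] -/
theorem totalDensity_eq (y z : ℝ) :
    contactB y z + contactB z y = stripMuY₂ 1 y z ^ 2 * (2 * stripMuY₂ 1 y z ^ 2 - y - z) /
      (2 * (3 * (stripMuY₂ 1 y z ^ 2) ^ 2 - 2 * (y + z) * stripMuY₂ 1 y z ^ 2 + y * z)) := by
  rw [contactB_swap y z]
  unfold contactB sexticDeriv
  have e : (stripMuY₂ 1 y z ^ 2 - y) * (stripMuY₂ 1 y z ^ 2 - z) + stripMuY₂ 1 y z ^ 2 * (stripMuY₂ 1 y z ^ 2 - z) +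
      stripMuY₂ 1 y z ^ 2 * (stripMuY₂ 1 y z ^ 2 - y) =
      3 * (stripMuY₂ 1 y z ^ 2) ^ 2 - 2 * (y + z) * stripMuY₂ 1 y z ^ 2 + y * z := by ring
  rw [e, ← add_div]; ring

/-- The scaled total density `T(σ) = σ(2σ − p)/(2(3σ² − 2pσ + q))` (`p = y+z`, `q = yz`) is STRICTLY DECREASING in `σ` on `(max(y,z), ∞)`:
for `max(y,z) < a < b`, `T(b) < T(a)` — the algebraic heart: `T(a) − T(b) ∝ (b − a)·[(y+z)ab + (y+z)yz − 2yz(a+b)] > 0`.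
[cite: BeatonBousquetMelouDeGierDuminilCopinGuttmann2014, §3.2 Proposition 6 (arXiv v5 p. 10); MadrasSlade1993, §1.2 (elementary)] -/
theorem scaledTotal_strictAnti (hy : 0 < y) (hz : 0 < z) {a b : ℝ} (hya : y < a) (hza : z < a) (hab : a < b) :
    b * (2 * b - (y + z)) / (2 * (3 * b ^ 2 - 2 * (y + z) * b + y * z)) <
      a * (2 * a - (y + z)) / (2 * (3 * a ^ 2 - 2 * (y + z) * a + y * z)) := by
  have hyb : y < b := hya.trans hab
  have hzb : z < b := hza.trans hab
  have hDa : 0 < 3 * a ^ 2 - 2 * (y + z) * a + y * z := by nlinarith [mul_pos (sub_pos.2 hya) (sub_pos.2 hza)]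
  have hDb : 0 < 3 * b ^ 2 - 2 * (y + z) * b + y * z := by nlinarith [mul_pos (sub_pos.2 hyb) (sub_pos.2 hzb)]
  rw [div_lt_div_iff₀ (by positivity) (by positivity)]
  -- the bracket `(y+z)ab + (y+z)yz − 2yz(a+b) > 0`
  have hca : 0 < (y + z) * a - 2 * y * z := by nlinarith
  have hbr : 0 < (y + z) * a * b + (y + z) * y * z - 2 * y * z * (a + b) := by
    have h1 : ((y + z) * a - 2 * y * z) * a ≤ ((y + z) * a - 2 * y * z) * b :=
      mul_le_mul_of_nonneg_left hab.le hca.le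
    -- at `b = a`: `(y+z)a² + (y+z)yz − 4yza = y(a−z)² + z(a−y)²·?` : use `(y+z)a² − 4yza + (y+z)yz = y(a − z)² + z(a − y)²`
    nlinarith [mul_pos hy (pow_pos (sub_pos.2 hza) 2), mul_pos hz (pow_pos (sub_pos.2 hya) 2), mul_pos (sub_pos.2 hab) hca]
  nlinarith [mul_pos (sub_pos.2 hab) hbr, hDa, hDb]

/-- `x ↦ x(x−y)(x−z)` is monotone on `[max(y,z), ∞)`. [cite: BeatonBousquetMelouDeGierDuminilCopinGuttmann2014, §3.2 Proposition 6 (arXiv v5 p. 10) (lane plumbing)] -/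
theorem cubic_mono {x₁ x₂ : ℝ} (hy1 : y ≤ x₁) (hz1 : z ≤ x₁) (h12 : x₁ ≤ x₂) (hy : 0 ≤ y) :
    x₁ * (x₁ - y) * (x₁ - z) ≤ x₂ * (x₂ - y) * (x₂ - z) := by
  have h0 : 0 ≤ x₁ := hy.trans hy1
  apply mul_le_mul (mul_le_mul h12 (by linarith) (by linarith) (h0.trans h12)) (by linarith) (by linarith)
  exact mul_nonneg (h0.trans h12) (by linarith)

/-- ★★ **The total surface-contact density is STRICTLY INCREASING along every ray**: for `y, z > 0` and `0 < u < u'`,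
`b(yu,zu) + b(zu,yu) < b(yu',zu') + b(zu',yu')`.  [With `σ = μ_1(yu,zu)²/u` the sextic law reads `σ(σ−y)(σ−z) = yz/u`, so `σ` DEcreases
along the ray, and `t = σ(2σ−y−z)/(2(3σ²−2(y+z)σ+yz))` decreases in `σ` (`scaledTotal_strictAnti`).]
[cite: BeatonBousquetMelouDeGierDuminilCopinGuttmann2014, §3.2 Proposition 6 (arXiv v5 p. 10); MadrasSlade1993, §1.2] -/
theorem totalDensity_ray_strictMono (hy : 0 < y) (hz : 0 < z) {u u' : ℝ} (hu : 0 < u) (huu' : u < u') :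
    contactB (y * u) (z * u) + contactB (z * u) (y * u) < contactB (y * u') (z * u') + contactB (z * u') (y * u') := by
  have hu' : 0 < u' := hu.trans huu'
  have hyu : 0 < y * u := mul_pos hy hu
  have hzu : 0 < z * u := mul_pos hz hu
  have hyu' : 0 < y * u' := mul_pos hy hu'
  have hzu' : 0 < z * u' := mul_pos hz hu'
  set s := stripMuY₂ 1 (y * u) (z * u) ^ 2 with hs
  set s' := stripMuY₂ 1 (y * u') (z * u') ^ 2 with hs'
  obtain ⟨hys, hzs⟩ := lt_stripMuY₂_one_sq₂ hyu hzu
  obtain ⟨hys', hzs'⟩ := lt_stripMuY₂_one_sq₂ hyu' hzu'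
  have hsex : s * (s - y * u) * (s - z * u) = y * u * (z * u) := stripMuY₂_one_sq_poly_eq hyu hzu
  have hsex' : s' * (s' - y * u') * (s' - z * u') = y * u' * (z * u') := stripMuY₂_one_sq_poly_eq hyu' hzu'
  -- scaled variables
  set σ := s / u with hσ
  set σ' := s' / u' with hσ'
  have hsσ : s = u * σ := by rw [hσ]; field_simp
  have hsσ' : s' = u' * σ' := by rw [hσ']; field_simp
  have hyσ : y < σ := by rw [hσ, lt_div_iff₀ hu]; linarith
  have hzσ : z < σ := by rw [hσ, lt_div_iff₀ hu]; linarith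
  have hyσ' : y < σ' := by rw [hσ', lt_div_iff₀ hu']; linarith
  have hzσ' : z < σ' := by rw [hσ', lt_div_iff₀ hu']; linarith
  have hg : σ * (σ - y) * (σ - z) = y * z / u := by
    rw [eq_div_iff hu.ne']
    have : u ^ 3 * (σ * (σ - y) * (σ - z)) = u ^ 2 * (y * z) := by
      rw [hsσ] at hsex; linear_combination hsex
    have hu2 : u ^ 2 ≠ 0 := pow_ne_zero 2 hu.ne'
    calc σ * (σ - y) * (σ - z) * u = (u ^ 3 * (σ * (σ - y) * (σ - z))) / u ^ 2 := by field_simp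
      _ = y * z := by rw [this]; field_simp
  have hg' : σ' * (σ' - y) * (σ' - z) = y * z / u' := by
    rw [eq_div_iff hu'.ne']
    have : u' ^ 3 * (σ' * (σ' - y) * (σ' - z)) = u' ^ 2 * (y * z) := by
      rw [hsσ'] at hsex'; linear_combination hsex'
    calc σ' * (σ' - y) * (σ' - z) * u' = (u' ^ 3 * (σ' * (σ' - y) * (σ' - z))) / u' ^ 2 := by field_simp
      _ = y * z := by rw [this]; field_simp
  -- `σ' < σ`: the cubic is monotone and `yz/u' < yz/u`
  have hσσ : σ' < σ := by
    by_contra hle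
    rw [not_lt] at hle
    have hmono := cubic_mono hyσ.le hzσ.le hle hy.le
    rw [hg, hg'] at hmono
    have : y * z / u' < y * z / u := div_lt_div_of_pos_left (mul_pos hy hz) hu huu'
    linarith
  -- `t = T(σ)` on both sides
  have hT : ∀ {v τ S : ℝ}, 0 < v → S = v * τ → S = stripMuY₂ 1 (y * v) (z * v) ^ 2 →
      contactB (y * v) (z * v) + contactB (z * v) (y * v) = τ * (2 * τ - (y + z)) / (2 * (3 * τ ^ 2 - 2 * (y + z) * τ + y * z)) := by
    intro v τ S hv hSτ hS
    rw [totalDensity_eq, ← hS, hSτ]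
    have hv2 : v ^ 2 ≠ 0 := pow_ne_zero 2 hv.ne'
    have e1 : v * τ * (2 * (v * τ) - y * v - z * v) = v ^ 2 * (τ * (2 * τ - (y + z))) := by ring
    have e2 : 2 * (3 * (v * τ) ^ 2 - 2 * (y * v + z * v) * (v * τ) + y * v * (z * v)) =
        v ^ 2 * (2 * (3 * τ ^ 2 - 2 * (y + z) * τ + y * z)) := by ring
    rw [e1, e2, mul_div_mul_left _ _ hv2]
  rw [hT hu hsσ hs, hT hu' hsσ' hs']
  exact scaledTotal_strictAnti hy hz hyσ' hzσ' hσσ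

/-! ## §2 The free energy along a ray: derivative `t`, strict tangent inequality, the ray rate `I_ray(y,z;u)` -/

/-- The four one-variable tangent bounds along a ray: for `Y, Z, u' > 0`, `ℓ = log u'`,
`(b(Y,Zu') − b(Y,Z))·ℓ ≤ [log μ_1(Yu',Zu') − log μ_1(Y,Z)] − t(Y,Z)·ℓ ≤ (b(Yu',Zu') − b(Y,Z) + b(Zu',Y) − b(Z,Y))·ℓ`, `t = b(Y,Z) + b(Z,Y)`.
[cite: BeatonBousquetMelouDeGierDuminilCopinGuttmann2014, §3.2 Proposition 6 (arXiv v5 p. 10); MadrasSlade1993, §1.2] -/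
theorem log_stripMuY₂_ray_sub_mem {Y Z u' : ℝ} (hY : 0 < Y) (hZ : 0 < Z) (hu' : 0 < u') :
    (contactB Y (Z * u') - contactB Y Z) * Real.log u' ≤
        (Real.log (stripMuY₂ 1 (Y * u') (Z * u')) - Real.log (stripMuY₂ 1 Y Z)) -
          (contactB Y Z + contactB Z Y) * Real.log u' ∧
      (Real.log (stripMuY₂ 1 (Y * u') (Z * u')) - Real.log (stripMuY₂ 1 Y Z)) -
          (contactB Y Z + contactB Z Y) * Real.log u' ≤
        (contactB (Y * u') (Z * u') - contactB Y Z + (contactB (Z * u') Y - contactB Z Y)) * Real.log u' := by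
  have hYu : 0 < Y * u' := mul_pos hY hu'
  have hZu : 0 < Z * u' := mul_pos hZ hu'
  have hℓY : Real.log (Y * u') - Real.log Y = Real.log u' := by rw [Real.log_mul hY.ne' hu'.ne']; ring
  have hℓZ : Real.log (Z * u') - Real.log Z = Real.log u' := by rw [Real.log_mul hZ.ne' hu'.ne']; ring
  have hsym : stripMuY₂ 1 Y (Z * u') = stripMuY₂ 1 (Z * u') Y := stripMuY₂_symm 1 Y (Z * u')
  -- A = Λ(Yu',Zu') − Λ(Y,Zu') : tangents in the first variable (second argument `Zu'`)
  have hA1 := mul_log_sub_le_log_stripMuY₂_sub hZu hYu hY      -- at `Y`, evaluated at `Yu'`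
  have hA2 := mul_log_sub_le_log_stripMuY₂_sub hZu hY hYu      -- at `Yu'`, evaluated at `Y`
  -- B = Λ(Zu',Y) − Λ(Z,Y) : tangents in the first variable (second argument `Y`)
  have hB1 := mul_log_sub_le_log_stripMuY₂_sub hY hZu hZ
  have hB2 := mul_log_sub_le_log_stripMuY₂_sub hY hZ hZu
  rw [hℓY] at hA1; rw [hℓZ] at hB1
  have hA2' : Real.log (stripMuY₂ 1 (Y * u') (Z * u')) - Real.log (stripMuY₂ 1 Y (Z * u')) ≤
      contactB (Y * u') (Z * u') * Real.log u' := by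
    have : Real.log Y - Real.log (Y * u') = -Real.log u' := by rw [Real.log_mul hY.ne' hu'.ne']; ring
    rw [this] at hA2; linarith
  have hB2' : Real.log (stripMuY₂ 1 (Z * u') Y) - Real.log (stripMuY₂ 1 Z Y) ≤ contactB (Z * u') Y * Real.log u' := by
    have : Real.log Z - Real.log (Z * u') = -Real.log u' := by rw [Real.log_mul hZ.ne' hu'.ne']; ring
    rw [this] at hB2; linarith
  have e : Real.log (stripMuY₂ 1 (Y * u') (Z * u')) - Real.log (stripMuY₂ 1 Y Z) =
      (Real.log (stripMuY₂ 1 (Y * u') (Z * u')) - Real.log (stripMuY₂ 1 Y (Z * u'))) +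
        (Real.log (stripMuY₂ 1 (Z * u') Y) - Real.log (stripMuY₂ 1 Z Y)) := by
    rw [hsym, stripMuY₂_symm 1 Z Y]; ring
  constructor
  · nlinarith [hA1, hB1, e]
  · nlinarith [hA2', hB2', e]

/-- ★★ **The free energy along a ray is differentiable with derivative the total contact density**:
`d/dτ log μ_1(y eᵗ, z eᵗ)|_{τ} = t(y eᵗ, z eᵗ) = b + b_top` (both walls respond; squeeze + joint continuity of `b`).
[cite: BeatonBousquetMelouDeGierDuminilCopinGuttmann2014, §3.2 Proposition 6 (arXiv v5 p. 10); MadrasSlade1993, §1.2] -/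
theorem hasDerivAt_log_stripMuY₂_ray_exp (hy : 0 < y) (hz : 0 < z) (τ : ℝ) :
    HasDerivAt (fun τ => Real.log (stripMuY₂ 1 (y * Real.exp τ) (z * Real.exp τ)))
      (contactB (y * Real.exp τ) (z * Real.exp τ) + contactB (z * Real.exp τ) (y * Real.exp τ)) τ := by
  have hY : 0 < y * Real.exp τ := mul_pos hy (Real.exp_pos τ)
  have hZ : 0 < z * Real.exp τ := mul_pos hz (Real.exp_pos τ)
  set Y := y * Real.exp τ with hYd
  set Z := z * Real.exp τ with hZd
  -- joint continuity of `b` at `(Y,Z)` and `(Z,Y)` along the curves we need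
  have hcYZ := continuousAt_contactB₂ hY hZ
  have hcZY := continuousAt_contactB₂ hZ hY
  have hexp1 : ContinuousAt (fun τ' : ℝ => Real.exp (τ' - τ)) τ := (Real.continuous_exp.comp (continuous_id.sub continuous_const)).continuousAt
  have hexp1' : Tendsto (fun τ' : ℝ => Real.exp (τ' - τ)) (𝓝 τ) (𝓝 1) := by
    have := hexp1.tendsto; simpa using this
  have hYc : Tendsto (fun τ' : ℝ => Y * Real.exp (τ' - τ)) (𝓝 τ) (𝓝 Y) := by simpa using hexp1'.const_mul Y
  have hZc : Tendsto (fun τ' : ℝ => Z * Real.exp (τ' - τ)) (𝓝 τ) (𝓝 Z) := by simpa using hexp1'.const_mul Z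
  have h1 : Tendsto (fun τ' => contactB Y (Z * Real.exp (τ' - τ))) (𝓝 τ) (𝓝 (contactB Y Z)) := by
    have := hcYZ.tendsto.comp (tendsto_const_nhds.prodMk_nhds hZc); simpa [Function.comp_def] using this
  have h2 : Tendsto (fun τ' => contactB (Y * Real.exp (τ' - τ)) (Z * Real.exp (τ' - τ))) (𝓝 τ) (𝓝 (contactB Y Z)) := by
    have := hcYZ.tendsto.comp (hYc.prodMk_nhds hZc); simpa [Function.comp_def] using this
  have h3 : Tendsto (fun τ' => contactB (Z * Real.exp (τ' - τ)) Y) (𝓝 τ) (𝓝 (contactB Z Y)) := by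
    have := hcZY.tendsto.comp (hZc.prodMk_nhds tendsto_const_nhds); simpa [Function.comp_def] using this
  have hE0 : Tendsto (fun τ' => |contactB Y (Z * Real.exp (τ' - τ)) - contactB Y Z| +
      (|contactB (Y * Real.exp (τ' - τ)) (Z * Real.exp (τ' - τ)) - contactB Y Z| +
        |contactB (Z * Real.exp (τ' - τ)) Y - contactB Z Y|)) (𝓝 τ) (𝓝 0) := by
    have := ((h1.sub_const (contactB Y Z)).abs.add
      (((h2.sub_const (contactB Y Z)).abs).add ((h3.sub_const (contactB Z Y)).abs)))
    simpa using this
  -- the function in the variable `u' = e^{τ'−τ}`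
  have hfun : ∀ τ', Real.log (stripMuY₂ 1 (y * Real.exp τ') (z * Real.exp τ')) =
      Real.log (stripMuY₂ 1 (Y * Real.exp (τ' - τ)) (Z * Real.exp (τ' - τ))) := by
    intro τ'
    have e : Real.exp τ' = Real.exp τ * Real.exp (τ' - τ) := by rw [← Real.exp_add]; ring_nf
    rw [hYd, hZd, e]; ring_nf
  rw [hasDerivAt_iff_tendsto_slope]
  have hmain : ∀ τ', τ' ≠ τ →
      |slope (fun τ => Real.log (stripMuY₂ 1 (y * Real.exp τ) (z * Real.exp τ))) τ τ' - (contactB Y Z + contactB Z Y)| ≤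
        |contactB Y (Z * Real.exp (τ' - τ)) - contactB Y Z| +
          (|contactB (Y * Real.exp (τ' - τ)) (Z * Real.exp (τ' - τ)) - contactB Y Z| +
            |contactB (Z * Real.exp (τ' - τ)) Y - contactB Z Y|) := by
    intro τ' hne
    have hu' : 0 < Real.exp (τ' - τ) := Real.exp_pos _
    have hℓ0 : τ' - τ ≠ 0 := sub_ne_zero.2 hne
    obtain ⟨hlo, hhi⟩ := log_stripMuY₂_ray_sub_mem hY hZ hu'
    rw [Real.log_exp] at hlo hhi
    rw [slope_def_field, hfun τ', hfun τ]
    simp only [sub_self, Real.exp_zero, mul_one]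
    set ℓ := τ' - τ with hℓ
    set D := Real.log (stripMuY₂ 1 (Y * Real.exp ℓ) (Z * Real.exp ℓ)) - Real.log (stripMuY₂ 1 Y Z) with hD
    set t := contactB Y Z + contactB Z Y with ht
    set Δ₁ := contactB Y (Z * Real.exp ℓ) - contactB Y Z with hΔ₁
    set Δ₂ := contactB (Y * Real.exp ℓ) (Z * Real.exp ℓ) - contactB Y Z with hΔ₂
    set Δ₃ := contactB (Z * Real.exp ℓ) Y - contactB Z Y with hΔ₃
    have e1 : D / ℓ - t = (D - t * ℓ) / ℓ := by field_simp
    rw [e1, abs_div, div_le_iff₀ (abs_pos.2 hℓ0)]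
    have hlo' : Δ₁ * ℓ ≤ D - t * ℓ := by rw [hΔ₁]; linarith
    have hhi' : D - t * ℓ ≤ (Δ₂ + Δ₃) * ℓ := by rw [hΔ₂, hΔ₃]; linarith
    have habs : |D - t * ℓ| ≤ |Δ₁ * ℓ| + |(Δ₂ + Δ₃) * ℓ| :=
      abs_le.2 ⟨by linarith [neg_abs_le (Δ₁ * ℓ), abs_nonneg ((Δ₂ + Δ₃) * ℓ)],
        by linarith [le_abs_self ((Δ₂ + Δ₃) * ℓ), abs_nonneg (Δ₁ * ℓ)]⟩
    refine habs.trans ?_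
    rw [abs_mul, abs_mul]
    have h23 := abs_add_le Δ₂ Δ₃
    nlinarith [abs_nonneg ℓ, abs_nonneg Δ₁]
  have h0 : Tendsto (fun τ' => slope (fun τ => Real.log (stripMuY₂ 1 (y * Real.exp τ) (z * Real.exp τ))) τ τ' -
      (contactB Y Z + contactB Z Y)) (𝓝[≠] τ) (𝓝 0) :=
    squeeze_zero_norm' (by filter_upwards [self_mem_nhdsWithin] with τ' hτ'; exact hmain τ' hτ')
      (hE0.mono_left nhdsWithin_le_nhds)
  have := h0.add_const (contactB Y Z + contactB Z Y)
  simpa using this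

/-- ★★ **Strict tangent inequality along a ray**: for `u > 0`, `u ≠ 1`,
`t(y,z)·log u < log μ_1(yu,zu) − log μ_1(y,z)` (mean value theorem on `τ ↦ log μ_1(yeᵗ, zeᵗ)` + `totalDensity_ray_strictMono`).
[cite: BeatonBousquetMelouDeGierDuminilCopinGuttmann2014, §3.2 Proposition 6 (arXiv v5 p. 10); MadrasSlade1993, §1.2] -/
theorem total_mul_log_lt_log_stripMuY₂_ray_sub (hy : 0 < y) (hz : 0 < z) {u : ℝ} (hu : 0 < u) (hne : u ≠ 1) :
    (contactB y z + contactB z y) * Real.log u < Real.log (stripMuY₂ 1 (y * u) (z * u)) - Real.log (stripMuY₂ 1 y z) := by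
  set g : ℝ → ℝ := fun τ => Real.log (stripMuY₂ 1 (y * Real.exp τ) (z * Real.exp τ)) with hg
  have hderiv : ∀ τ, HasDerivAt g (contactB (y * Real.exp τ) (z * Real.exp τ) + contactB (z * Real.exp τ) (y * Real.exp τ)) τ :=
    fun τ => hasDerivAt_log_stripMuY₂_ray_exp hy hz τ
  have hg0 : g 0 = Real.log (stripMuY₂ 1 y z) := by simp [hg]
  have hgu : g (Real.log u) = Real.log (stripMuY₂ 1 (y * u) (z * u)) := by simp only [hg, Real.exp_log hu]
  have ht1 : contactB y z + contactB z y = contactB (y * 1) (z * 1) + contactB (z * 1) (y * 1) := by simp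
  rcases lt_or_gt_of_ne hne with hlt | hlt
  · have hll : Real.log u < 0 := Real.log_neg hu hlt
    obtain ⟨τ, hτ, hslope⟩ := exists_hasDerivAt_eq_slope g
      (fun τ => contactB (y * Real.exp τ) (z * Real.exp τ) + contactB (z * Real.exp τ) (y * Real.exp τ)) hll
      (fun t _ => (hderiv t).continuousAt.continuousWithinAt) (fun t _ => hderiv t)
    have hτt : contactB (y * Real.exp τ) (z * Real.exp τ) + contactB (z * Real.exp τ) (y * Real.exp τ) <
        contactB y z + contactB z y := by
      rw [ht1]; exact totalDensity_ray_strictMono hy hz (Real.exp_pos τ) (by have := Real.exp_lt_exp.2 hτ.2; simpa using this)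
    rw [hgu, hg0] at hslope
    have hpos : 0 < 0 - Real.log u := by linarith
    have key := mul_lt_mul_of_pos_right hτt hpos
    rw [hslope, div_mul_cancel₀ _ hpos.ne'] at key
    linarith
  · have hll : 0 < Real.log u := Real.log_pos hlt
    obtain ⟨τ, hτ, hslope⟩ := exists_hasDerivAt_eq_slope g
      (fun τ => contactB (y * Real.exp τ) (z * Real.exp τ) + contactB (z * Real.exp τ) (y * Real.exp τ)) hll
      (fun t _ => (hderiv t).continuousAt.continuousWithinAt) (fun t _ => hderiv t)
    have hτt : contactB y z + contactB z y <
        contactB (y * Real.exp τ) (z * Real.exp τ) + contactB (z * Real.exp τ) (y * Real.exp τ) := by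
      rw [ht1]; exact totalDensity_ray_strictMono hy hz one_pos (by have := Real.exp_lt_exp.2 hτ.1; simpa using this)
    rw [hgu, hg0] at hslope
    have hpos : 0 < Real.log u - 0 := by linarith
    have key := mul_lt_mul_of_pos_right hτt hpos
    rw [hslope, div_mul_cancel₀ _ hpos.ne'] at key
    linarith

/-- ★ **The ray rate** `I_ray(y,z;u) = t(yu,zu)·log u − log(μ_1(yu,zu)/μ_1(y,z))`, `t = b + b_top`: the exponential cost under `P_{N,y,z}` of a
total surface-contact fraction `≈ t(yu,zu)` (equivalently a rung density `≈ ρ(yu,zu) = 1 − 2t(yu,zu)`).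
[cite: DemboZeitouni2010, §2.2 Theorem 2.2.3 (Cramér); JansevanRensburg2000, §3.2 Theorems 3.17–3.19] -/
def rayRate (y z u : ℝ) : ℝ :=
  (contactB (y * u) (z * u) + contactB (z * u) (y * u)) * Real.log u - Real.log (stripMuY₂ 1 (y * u) (z * u) / stripMuY₂ 1 y z)

/-- `I_ray(y,z;1) = 0`. [cite: DemboZeitouni2010, §2.2 (lane plumbing)] -/
theorem rayRate_one (hy : 0 < y) (hz : 0 < z) : rayRate y z 1 = 0 := by
  unfold rayRate; rw [mul_one, mul_one, div_self (stripMuY₂_pos 1 hy hz).ne', Real.log_one]; ring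

/-- ★★ `I_ray(y,z;u) > 0` for `u ≠ 1` (strict convexity of the free energy along rays). [cite: DemboZeitouni2010, §2.2 Theorem 2.2.3] -/
theorem rayRate_pos (hy : 0 < y) (hz : 0 < z) {u : ℝ} (hu : 0 < u) (hne : u ≠ 1) : 0 < rayRate y z u := by
  have hyu : 0 < y * u := mul_pos hy hu
  have hzu : 0 < z * u := mul_pos hz hu
  unfold rayRate
  rw [Real.log_div (stripMuY₂_pos 1 hyu hzu).ne' (stripMuY₂_pos 1 hy hz).ne']
  -- strict tangent at `(yu, zu)` along the ray back to `(y,z)`: parameter `u⁻¹`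
  have h := total_mul_log_lt_log_stripMuY₂_ray_sub hyu hzu (inv_pos.2 hu) (by
    intro h1; apply hne; rw [inv_eq_one] at h1; exact h1)
  rw [Real.log_inv, mul_assoc, mul_assoc, mul_inv_cancel₀ hu.ne', mul_one, mul_one] at h
  linarith

/-! ## §3 The LDP of the total surface contacts and of the rung density under EVERY `P_{N,y,z}` -/

/-- Continuity at `u₀` of the ray window cost `u' ↦ max(a log u', (2t(yu',zu') − a) log u') − log(μ_1(yu',zu')/μ_1(y,z))`.
[cite: DemboZeitouni2010, §2.2 (lane plumbing)] -/
theorem continuousAt_windowCostRay (hy : 0 < y) (hz : 0 < z) {u₀ : ℝ} (hu₀ : 0 < u₀) (a : ℝ) :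
    ContinuousAt (fun u' => max (a * Real.log u') ((2 * (contactB (y * u') (z * u') + contactB (z * u') (y * u')) - a) *
      Real.log u') - Real.log (stripMuY₂ 1 (y * u') (z * u') / stripMuY₂ 1 y z)) u₀ := by
  have hyu : 0 < y * u₀ := mul_pos hy hu₀
  have hzu : 0 < z * u₀ := mul_pos hz hu₀
  have hlog : ContinuousAt (fun u' : ℝ => Real.log u') u₀ := Real.continuousAt_log hu₀.ne'
  have hlin : ContinuousAt (fun u' : ℝ => (y * u', z * u')) u₀ :=
    (continuousAt_const.mul continuousAt_id).prodMk (continuousAt_const.mul continuousAt_id)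
  have hlin' : ContinuousAt (fun u' : ℝ => (z * u', y * u')) u₀ :=
    (continuousAt_const.mul continuousAt_id).prodMk (continuousAt_const.mul continuousAt_id)
  have hb1' := ContinuousAt.comp_of_eq (continuousAt_contactB₂ hyu hzu) hlin rfl
  have hb2' := ContinuousAt.comp_of_eq (continuousAt_contactB₂ hzu hyu) hlin' rfl
  simp only [Function.comp_def] at hb1' hb2'
  have hb1 : ContinuousAt (fun u' => contactB (y * u') (z * u')) u₀ := hb1'
  have hb2 : ContinuousAt (fun u' => contactB (z * u') (y * u')) u₀ := hb2'
  have hμc : ContinuousAt (fun p : ℝ × ℝ => stripMuY₂ 1 p.1 p.2) (y * u₀, z * u₀) :=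
    (continuousOn_stripMuY₂ 1).continuousAt ((isOpen_Ioi.prod isOpen_Ioi).mem_nhds ⟨hyu, hzu⟩)
  have hμ' := ContinuousAt.comp_of_eq hμc hlin rfl
  simp only [Function.comp_def] at hμ'
  have hμ'' : ContinuousAt (fun u' => stripMuY₂ 1 (y * u') (z * u')) u₀ := hμ'
  have hμ : ContinuousAt (fun u' => Real.log (stripMuY₂ 1 (y * u') (z * u') / stripMuY₂ 1 y z)) u₀ :=
    (hμ''.div_const _).log (div_pos (stripMuY₂_pos 1 hyu hzu) (stripMuY₂_pos 1 hy hz)).ne'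
  have hA : ContinuousAt (fun u' : ℝ => a * Real.log u') u₀ := continuousAt_const.mul hlog
  have hB : ContinuousAt (fun u' : ℝ => (2 * (contactB (y * u') (z * u') + contactB (z * u') (y * u')) - a) *
      Real.log u') u₀ := ((continuousAt_const.mul (hb1.add hb2)).sub continuousAt_const).mul hlog
  have hAB : ContinuousAt (fun u' : ℝ => max (a * Real.log u') ((2 * (contactB (y * u') (z * u') +
      contactB (z * u') (y * u')) - a) * Real.log u')) u₀ := hA.max hB
  exact hAB.sub hμ

open Classical in
/-- ★★★ **TWO-SIDED EXPONENTIAL BOUNDS FOR THE TOTAL SURFACE CONTACTS under every `P_{N,y,z}` — upper tail**: for `y, z > 0`, `u ≥ 1`,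
every real shift `d` and `ε > 0`, eventually `exp(−N(I_ray + ε)) ≤ P_{N,y,z}(bc + tc ≥ t(yu,zu)·N + d) ≤ exp(−N(I_ray − ε))`, `I_ray = rayRate y z u`.
[cite: DemboZeitouni2010, §2.2 Theorem 2.2.3 (Cramér); JansevanRensburg2000, §3.2 Theorems 3.17–3.19] -/
theorem totalContactsRay_ge_exp_bounds (hy : 0 < y) (hz : 0 < z) {u : ℝ} (hu : 1 ≤ u) (d : ℝ) {ε : ℝ} (hε : 0 < ε) :
    (∀ᶠ N : ℕ in atTop, Real.exp ((-rayRate y z u - ε) * N) ≤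
        (∑ q ∈ (stripPairs 1 N).filter
          (fun q => (contactB (y * u) (z * u) + contactB (z * u) (y * u)) * N + d ≤
            ((bottomVisits₀ q.1 q.2 N + topVisits₀ 1 q.1 q.2 N : ℕ) : ℝ)), wgt y z N q) / stripZ₂ 1 N y z) ∧
    (∀ᶠ N : ℕ in atTop,
        (∑ q ∈ (stripPairs 1 N).filter
          (fun q => (contactB (y * u) (z * u) + contactB (z * u) (y * u)) * N + d ≤
            ((bottomVisits₀ q.1 q.2 N + topVisits₀ 1 q.1 q.2 N : ℕ) : ℝ)), wgt y z N q) / stripZ₂ 1 N y z ≤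
          Real.exp ((-rayRate y z u + ε) * N)) := by
  have hu0 : 0 < u := one_pos.trans_le hu
  have hyu : 0 < y * u := mul_pos hy hu0
  have hzu : 0 < z * u := mul_pos hz hu0
  set a := contactB (y * u) (z * u) + contactB (z * u) (y * u) with ha
  constructor
  · have hε2 : 0 < ε / 2 := by linarith
    have hval : max (a * Real.log u) ((2 * (contactB (y * u) (z * u) + contactB (z * u) (y * u)) - a) * Real.log u) -
        Real.log (stripMuY₂ 1 (y * u) (z * u) / stripMuY₂ 1 y z) = rayRate y z u := by
      rw [ha, show 2 * (contactB (y * u) (z * u) + contactB (z * u) (y * u)) -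
        (contactB (y * u) (z * u) + contactB (z * u) (y * u)) = contactB (y * u) (z * u) + contactB (z * u) (y * u) by ring,
        max_self]; rfl
    have hev : ∀ᶠ u' in 𝓝 u, max (a * Real.log u') ((2 * (contactB (y * u') (z * u') + contactB (z * u') (y * u')) - a) *
        Real.log u') - Real.log (stripMuY₂ 1 (y * u') (z * u') / stripMuY₂ 1 y z) < rayRate y z u + ε / 2 :=
      (continuousAt_windowCostRay hy hz hu0 a).eventually (gt_mem_nhds (by simp only [hval]; linarith))
    obtain ⟨u', hu'c, huu'⟩ := ((hev.filter_mono nhdsWithin_le_nhds).and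
      (self_mem_nhdsWithin : Set.Ioi u ∈ 𝓝[>] u)).exists
    have huu' : u < u' := huu'
    have hu' : 0 < u' := hu0.trans huu'
    have hb1 : a < contactB (y * u') (z * u') + contactB (z * u') (y * u') := totalDensity_ray_strictMono hy hz hu0 huu'
    have hb2 : contactB (y * u') (z * u') + contactB (z * u') (y * u') <
        2 * (contactB (y * u') (z * u') + contactB (z * u') (y * u')) - a := by linarith
    filter_upwards [exp_le_windowFractionT hy hz hu' hb1 hb2 d 0 hε2] with N hN
    refine le_trans ?_ (hN.trans ?_)
    · exact Real.exp_le_exp.2 (mul_le_mul_of_nonneg_right (by linarith) (Nat.cast_nonneg N))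
    · refine div_le_div_of_nonneg_right ?_ (stripZ₂_pos 1 N hy hz).le
      refine Finset.sum_le_sum_of_subset_of_nonneg (fun q hq => ?_) fun q _ _ => wgt_nonneg hy.le hz.le N q
      rw [Finset.mem_filter] at hq ⊢
      exact ⟨hq.1, hq.2.1⟩
  · have h := fraction_le_exp_of_chernoff₂ hy hz hyu hzu hu0 a d
      (fun N => ∑ q ∈ (stripPairs 1 N).filter
        (fun q => a * N + d ≤ ((bottomVisits₀ q.1 q.2 N + topVisits₀ 1 q.1 q.2 N : ℕ) : ℝ)), wgt y z N q)
      (fun N => by have h := sum_total_ge_mul_rpow_le hy.le hz.le hu N a d; rw [ha] at h ⊢; exact h) hε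
    filter_upwards [h] with N hN
    have e : -rayRate y z u + ε = -(a * Real.log u - Real.log (stripMuY₂ 1 (y * u) (z * u) / stripMuY₂ 1 y z)) + ε := rfl
    rw [e]; exact hN

open Classical in
/-- ★★★ **… lower tail**: for `0 < u ≤ 1`, eventually `exp(−N(I_ray + ε)) ≤ P_{N,y,z}(bc + tc ≤ t(yu,zu)·N + d) ≤ exp(−N(I_ray − ε))`.
[cite: DemboZeitouni2010, §2.2 Theorem 2.2.3 (Cramér); JansevanRensburg2000, §3.2 Theorems 3.17–3.19] -/
theorem totalContactsRay_le_exp_bounds (hy : 0 < y) (hz : 0 < z) {u : ℝ} (hu0 : 0 < u) (hu1 : u ≤ 1) (d : ℝ) {ε : ℝ} (hε : 0 < ε) :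
    (∀ᶠ N : ℕ in atTop, Real.exp ((-rayRate y z u - ε) * N) ≤
        (∑ q ∈ (stripPairs 1 N).filter
          (fun q => ((bottomVisits₀ q.1 q.2 N + topVisits₀ 1 q.1 q.2 N : ℕ) : ℝ) ≤
            (contactB (y * u) (z * u) + contactB (z * u) (y * u)) * N + d), wgt y z N q) / stripZ₂ 1 N y z) ∧
    (∀ᶠ N : ℕ in atTop,
        (∑ q ∈ (stripPairs 1 N).filter
          (fun q => ((bottomVisits₀ q.1 q.2 N + topVisits₀ 1 q.1 q.2 N : ℕ) : ℝ) ≤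
            (contactB (y * u) (z * u) + contactB (z * u) (y * u)) * N + d), wgt y z N q) / stripZ₂ 1 N y z ≤
          Real.exp ((-rayRate y z u + ε) * N)) := by
  have hyu : 0 < y * u := mul_pos hy hu0
  have hzu : 0 < z * u := mul_pos hz hu0
  set a := contactB (y * u) (z * u) + contactB (z * u) (y * u) with ha
  constructor
  · have hε2 : 0 < ε / 2 := by linarith
    have hval : max (a * Real.log u) ((2 * (contactB (y * u) (z * u) + contactB (z * u) (y * u)) - a) * Real.log u) -
        Real.log (stripMuY₂ 1 (y * u) (z * u) / stripMuY₂ 1 y z) = rayRate y z u := by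
      rw [ha, show 2 * (contactB (y * u) (z * u) + contactB (z * u) (y * u)) -
        (contactB (y * u) (z * u) + contactB (z * u) (y * u)) = contactB (y * u) (z * u) + contactB (z * u) (y * u) by ring,
        max_self]; rfl
    have hev : ∀ᶠ u' in 𝓝 u, max (a * Real.log u') ((2 * (contactB (y * u') (z * u') + contactB (z * u') (y * u')) - a) *
        Real.log u') - Real.log (stripMuY₂ 1 (y * u') (z * u') / stripMuY₂ 1 y z) < rayRate y z u + ε / 2 :=
      (continuousAt_windowCostRay hy hz hu0 a).eventually (gt_mem_nhds (by simp only [hval]; linarith))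
    obtain ⟨u', hu'c, huu'⟩ := ((hev.filter_mono nhdsWithin_le_nhds).and (Ioo_mem_nhdsLT hu0)).exists
    have hu' : 0 < u' := huu'.1
    have hb2 : contactB (y * u') (z * u') + contactB (z * u') (y * u') < a := totalDensity_ray_strictMono hy hz hu' huu'.2
    have hb1 : 2 * (contactB (y * u') (z * u') + contactB (z * u') (y * u')) - a <
        contactB (y * u') (z * u') + contactB (z * u') (y * u') := by linarith
    filter_upwards [exp_le_windowFractionT hy hz hu' hb1 hb2 0 d hε2] with N hN
    rw [max_comm] at hN
    refine le_trans ?_ (hN.trans ?_)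
    · exact Real.exp_le_exp.2 (mul_le_mul_of_nonneg_right (by linarith) (Nat.cast_nonneg N))
    · refine div_le_div_of_nonneg_right ?_ (stripZ₂_pos 1 N hy hz).le
      refine Finset.sum_le_sum_of_subset_of_nonneg (fun q hq => ?_) fun q _ _ => wgt_nonneg hy.le hz.le N q
      rw [Finset.mem_filter] at hq ⊢
      exact ⟨hq.1, hq.2.2⟩
  · have h := fraction_le_exp_of_chernoff₂ hy hz hyu hzu hu0 a d
      (fun N => ∑ q ∈ (stripPairs 1 N).filter
        (fun q => ((bottomVisits₀ q.1 q.2 N + topVisits₀ 1 q.1 q.2 N : ℕ) : ℝ) ≤ a * N + d), wgt y z N q)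
      (fun N => by have h := sum_total_le_mul_rpow_le hy.le hz.le hu0 hu1 N a d; rw [ha] at h ⊢; exact h) hε
    filter_upwards [h] with N hN
    have e : -rayRate y z u + ε = -(a * Real.log u - Real.log (stripMuY₂ 1 (y * u) (z * u) / stripMuY₂ 1 y z)) + ε := rfl
    rw [e]; exact hN

open Classical in
/-- ★★★ **THE LDP OF THE TOTAL SURFACE-CONTACT FRACTION under every two-wall measure `P_{N,y,z}`** (ray tilts): for `u ≥ 1`,
`(1/N) log P_{N,y,z}(bc + tc ≥ t(yu,zu)·N + d) → −I_ray(y,z;u)`, and for `0 < u ≤ 1` the same for `bc + tc ≤ t(yu,zu)·N + d`.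
[cite: DemboZeitouni2010, §2.2 Theorem 2.2.3 (Cramér); JansevanRensburg2000, §3.2 Theorems 3.17–3.19] -/
theorem tendsto_log_totalContactsRay_ge_le_div (hy : 0 < y) (hz : 0 < z) {u : ℝ} (hu0 : 0 < u) (d : ℝ) :
    (1 ≤ u → Tendsto (fun N : ℕ => Real.log ((∑ q ∈ (stripPairs 1 N).filter
        (fun q => (contactB (y * u) (z * u) + contactB (z * u) (y * u)) * N + d ≤
          ((bottomVisits₀ q.1 q.2 N + topVisits₀ 1 q.1 q.2 N : ℕ) : ℝ)), wgt y z N q) / stripZ₂ 1 N y z) / N)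
        atTop (𝓝 (-rayRate y z u))) ∧
    (u ≤ 1 → Tendsto (fun N : ℕ => Real.log ((∑ q ∈ (stripPairs 1 N).filter
        (fun q => ((bottomVisits₀ q.1 q.2 N + topVisits₀ 1 q.1 q.2 N : ℕ) : ℝ) ≤
          (contactB (y * u) (z * u) + contactB (z * u) (y * u)) * N + d), wgt y z N q) / stripZ₂ 1 N y z) / N)
        atTop (𝓝 (-rayRate y z u))) := by
  constructor
  · intro hu
    exact tendsto_log_div_of_exp_bounds (fun ε hε => (totalContactsRay_ge_exp_bounds hy hz hu d hε).1)
      (fun ε hε => (totalContactsRay_ge_exp_bounds hy hz hu d hε).2)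
  · intro hu1
    exact tendsto_log_div_of_exp_bounds (fun ε hε => (totalContactsRay_le_exp_bounds hy hz hu0 hu1 d hε).1)
      (fun ε hε => (totalContactsRay_le_exp_bounds hy hz hu0 hu1 d hε).2)

/-! ## §4 The rung density under every `P_{N,y,z}`: `2t(y,z) = 1 − ρ(y,z)` and the sandwich via the parity identity -/

/-- `2·t(Y,Z) = 1 − ρ(Y,Z)`: twice the total surface-contact density is one minus the rung density `ρ = twoWallRho` of the tree's
two-wall speed file (`t = v/2`, `v = 1 − ρ`). [cite: BeatonBousquetMelouDeGierDuminilCopinGuttmann2014, §3.2 Proposition 6 (arXiv v5 p. 10)] -/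
theorem two_mul_totalDensity {Y Z : ℝ} (hY : 0 < Y) (hZ : 0 < Z) :
    2 * (contactB Y Z + contactB Z Y) = 1 - twoWallRho Y Z := by
  have h := contactB_add_contactB_swap hY hZ
  unfold twoWallSpeed at h
  linarith

/-- The two inclusions between rung events and total-contact events under every pair of fugacities:
`bc+tc ≥ tN + 1 ⇒ V ≤ ρN ⇒ bc+tc ≥ tN` and `bc+tc ≤ tN ⇒ V ≥ ρN ⇒ bc+tc ≤ tN + 1` (`t = t(Y,Z)`, `ρ = ρ(Y,Z)`).
[cite: EntingJensen2009, §7.4.2, Fig. 7.10 (lane plumbing)] -/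
theorem rung_event_sandwich₂ {Y Z : ℝ} (hY : 0 < Y) (hZ : 0 < Z) {N : ℕ} {q : Site 2 × (ℕ → Site 2)} (hq : q ∈ stripPairs 1 N) :
    (((contactB Y Z + contactB Z Y) * N + 1 ≤ ((bottomVisits₀ q.1 q.2 N + topVisits₀ 1 q.1 q.2 N : ℕ) : ℝ) →
        (LadderPot.nV q N : ℝ) ≤ twoWallRho Y Z * N) ∧
      ((LadderPot.nV q N : ℝ) ≤ twoWallRho Y Z * N →
        (contactB Y Z + contactB Z Y) * N ≤ ((bottomVisits₀ q.1 q.2 N + topVisits₀ 1 q.1 q.2 N : ℕ) : ℝ))) ∧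
    ((((bottomVisits₀ q.1 q.2 N + topVisits₀ 1 q.1 q.2 N : ℕ) : ℝ) ≤ (contactB Y Z + contactB Z Y) * N →
        twoWallRho Y Z * N ≤ LadderPot.nV q N) ∧
      (twoWallRho Y Z * N ≤ LadderPot.nV q N →
        ((bottomVisits₀ q.1 q.2 N + topVisits₀ 1 q.1 q.2 N : ℕ) : ℝ) ≤ (contactB Y Z + contactB Z Y) * N + 1)) := by
  have h2 := two_mul_totalDensity hY hZ
  have hid := two_mul_totalVisits_add_nV hq
  have he0 : 0 ≤ WallPot.siteAt q N 0 % 2 := Int.emod_nonneg _ two_ne_zero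
  have he1 : WallPot.siteAt q N 0 % 2 < 2 := Int.emod_lt_of_pos _ two_pos
  have hf0 : 0 ≤ WallPot.siteAt q 0 0 % 2 := Int.emod_nonneg _ two_ne_zero
  have hf1 : WallPot.siteAt q 0 0 % 2 < 2 := Int.emod_lt_of_pos _ two_pos
  set T : ℝ := ((bottomVisits₀ q.1 q.2 N + topVisits₀ 1 q.1 q.2 N : ℕ) : ℝ) with hT
  set V : ℝ := (LadderPot.nV q N : ℝ) with hV
  have hidR : ∃ e : ℝ, 0 ≤ e ∧ e ≤ 2 ∧ 2 * T + V = N + e := by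
    refine ⟨((WallPot.siteAt q N 0 % 2 + WallPot.siteAt q 0 0 % 2 : ℤ) : ℝ), by exact_mod_cast (by omega),
      by exact_mod_cast (by omega), ?_⟩
    rw [hT, hV]
    have := congrArg (fun t : ℤ => (t : ℝ)) hid
    push_cast at this ⊢
    linarith
  obtain ⟨e, he0', he2', hide⟩ := hidR
  have hρ : twoWallRho Y Z * N = N - 2 * (contactB Y Z + contactB Z Y) * N := by rw [h2]; ring
  rw [hρ]
  refine ⟨⟨fun h => by linarith, fun h => by linarith⟩, ⟨fun h => by linarith, fun h => by linarith⟩⟩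

open Classical in
/-- ★★★ **THE RUNG-DENSITY LDP UNDER EVERY TWO-WALL MEASURE `P_{N,y,z}`**: for `y, z > 0` and `u ≥ 1`,
`(1/N) log P_{N,y,z}(V(ω) ≤ ρ(yu,zu)·N) → −I_ray(y,z;u)`, and for `0 < u ≤ 1`, `(1/N) log P_{N,y,z}(V(ω) ≥ ρ(yu,zu)·N) → −I_ray(y,z;u)`
(`ρ = twoWallRho` the tree's rung density, `ρ(y,z)` typical under `P_{N,y,z}`: `tendsto_twoWallRungDevFraction`; every rung density between
`ρ(y,z)` and the ray's end values is reached along the ray).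
[cite: DemboZeitouni2010, §2.2 Theorem 2.2.3 (Cramér); MadrasSlade1993, §1.1 eq. (1.1.5), §8.5 pp. 278–279; JansevanRensburg2000, §3.2 Theorems 3.17–3.19] -/
theorem tendsto_log_rungsRay_div (hy : 0 < y) (hz : 0 < z) {u : ℝ} (hu0 : 0 < u) :
    (1 ≤ u → Tendsto (fun N : ℕ => Real.log ((∑ q ∈ (stripPairs 1 N).filter
        (fun q => (LadderPot.nV q N : ℝ) ≤ twoWallRho (y * u) (z * u) * N), wgt y z N q) / stripZ₂ 1 N y z) / N)
        atTop (𝓝 (-rayRate y z u))) ∧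
    (u ≤ 1 → Tendsto (fun N : ℕ => Real.log ((∑ q ∈ (stripPairs 1 N).filter
        (fun q => twoWallRho (y * u) (z * u) * N ≤ (LadderPot.nV q N : ℝ)), wgt y z N q) / stripZ₂ 1 N y z) / N)
        atTop (𝓝 (-rayRate y z u))) := by
  have hyu : 0 < y * u := mul_pos hy hu0
  have hzu : 0 < z * u := mul_pos hz hu0
  constructor
  · intro hu
    refine tendsto_log_div_of_exp_bounds (fun ε hε => ?_) (fun ε hε => ?_)
    · filter_upwards [(totalContactsRay_ge_exp_bounds hy hz hu 1 hε).1] with N hN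
      refine hN.trans (div_le_div_of_nonneg_right ?_ (stripZ₂_pos 1 N hy hz).le)
      refine Finset.sum_le_sum_of_subset_of_nonneg (fun q hq => ?_) fun q _ _ => wgt_nonneg hy.le hz.le N q
      rw [Finset.mem_filter] at hq ⊢
      exact ⟨hq.1, (rung_event_sandwich₂ hyu hzu hq.1).1.1 hq.2⟩
    · filter_upwards [(totalContactsRay_ge_exp_bounds hy hz hu 0 hε).2] with N hN
      refine le_trans (div_le_div_of_nonneg_right ?_ (stripZ₂_pos 1 N hy hz).le) hN
      refine Finset.sum_le_sum_of_subset_of_nonneg (fun q hq => ?_) fun q _ _ => wgt_nonneg hy.le hz.le N q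
      rw [Finset.mem_filter] at hq ⊢
      have h := (rung_event_sandwich₂ hyu hzu hq.1).1.2 hq.2
      exact ⟨hq.1, by simpa using h⟩
  · intro hu1
    refine tendsto_log_div_of_exp_bounds (fun ε hε => ?_) (fun ε hε => ?_)
    · filter_upwards [(totalContactsRay_le_exp_bounds hy hz hu0 hu1 0 hε).1] with N hN
      refine hN.trans (div_le_div_of_nonneg_right ?_ (stripZ₂_pos 1 N hy hz).le)
      refine Finset.sum_le_sum_of_subset_of_nonneg (fun q hq => ?_) fun q _ _ => wgt_nonneg hy.le hz.le N q
      rw [Finset.mem_filter] at hq ⊢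
      have h2 : ((bottomVisits₀ q.1 q.2 N + topVisits₀ 1 q.1 q.2 N : ℕ) : ℝ) ≤
          (contactB (y * u) (z * u) + contactB (z * u) (y * u)) * N := by
        have := hq.2; simpa using this
      exact ⟨hq.1, (rung_event_sandwich₂ hyu hzu hq.1).2.1 h2⟩
    · filter_upwards [(totalContactsRay_le_exp_bounds hy hz hu0 hu1 1 hε).2] with N hN
      refine le_trans (div_le_div_of_nonneg_right ?_ (stripZ₂_pos 1 N hy hz).le) hN
      refine Finset.sum_le_sum_of_subset_of_nonneg (fun q hq => ?_) fun q _ _ => wgt_nonneg hy.le hz.le N q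
      rw [Finset.mem_filter] at hq ⊢
      exact ⟨hq.1, (rung_event_sandwich₂ hyu hzu hq.1).2.2 hq.2⟩

/-- ★ **Consistency with the diagonal**: on `y = z` the ray rate is the diagonal rate of the previous file, `I_ray(y,y;u) = I₂(y; yu)`.
[cite: DemboZeitouni2010, §2.2 (lane plumbing)] -/
theorem rayRate_self (hy : 0 < y) (u : ℝ) : rayRate y y u = diagRate y (y * u) := by
  unfold rayRate diagRate
  rw [mul_div_cancel_left₀ _ hy.ne']; ring

/-! ## §5 (ed.2) The rung density is always `< 1/3` and tends to `1/3` for infinitely repelling walls (`u → 0⁺` along every ray) -/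

/-- The total density through the scaled growth parameter: for `u > 0`, with `σ = μ_1(yu,zu)²/u`,
`t(yu,zu) = σ(2σ − (y+z))/(2(3σ² − 2(y+z)σ + yz))` and `σ(σ−y)(σ−z) = yz/u`, `σ > max(y,z)`.
[cite: BeatonBousquetMelouDeGierDuminilCopinGuttmann2014, §3.2 Proposition 6 (arXiv v5 p. 10)] -/
theorem totalDensity_ray_eq_scaled (hy : 0 < y) (hz : 0 < z) {u : ℝ} (hu : 0 < u) :
    contactB (y * u) (z * u) + contactB (z * u) (y * u) =
        (stripMuY₂ 1 (y * u) (z * u) ^ 2 / u) * (2 * (stripMuY₂ 1 (y * u) (z * u) ^ 2 / u) - (y + z)) /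
          (2 * (3 * (stripMuY₂ 1 (y * u) (z * u) ^ 2 / u) ^ 2 - 2 * (y + z) * (stripMuY₂ 1 (y * u) (z * u) ^ 2 / u) + y * z)) ∧
      (stripMuY₂ 1 (y * u) (z * u) ^ 2 / u) * (stripMuY₂ 1 (y * u) (z * u) ^ 2 / u - y) *
          (stripMuY₂ 1 (y * u) (z * u) ^ 2 / u - z) = y * z / u ∧
      y < stripMuY₂ 1 (y * u) (z * u) ^ 2 / u ∧ z < stripMuY₂ 1 (y * u) (z * u) ^ 2 / u := by
  have hyu : 0 < y * u := mul_pos hy hu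
  have hzu : 0 < z * u := mul_pos hz hu
  set s := stripMuY₂ 1 (y * u) (z * u) ^ 2 with hs
  obtain ⟨hys, hzs⟩ := lt_stripMuY₂_one_sq₂ hyu hzu
  have hsex : s * (s - y * u) * (s - z * u) = y * u * (z * u) := stripMuY₂_one_sq_poly_eq hyu hzu
  set σ := s / u with hσ
  have hsσ : s = u * σ := by rw [hσ]; field_simp
  have hyσ : y < σ := by rw [hσ, lt_div_iff₀ hu]; linarith
  have hzσ : z < σ := by rw [hσ, lt_div_iff₀ hu]; linarith
  refine ⟨?_, ?_, hyσ, hzσ⟩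
  · rw [totalDensity_eq, ← hs, hsσ]
    have hu2 : u ^ 2 ≠ 0 := pow_ne_zero 2 hu.ne'
    have e1 : u * σ * (2 * (u * σ) - y * u - z * u) = u ^ 2 * (σ * (2 * σ - (y + z))) := by ring
    have e2 : 2 * (3 * (u * σ) ^ 2 - 2 * (y * u + z * u) * (u * σ) + y * u * (z * u)) =
        u ^ 2 * (2 * (3 * σ ^ 2 - 2 * (y + z) * σ + y * z)) := by ring
    rw [e1, e2, mul_div_mul_left _ _ hu2]
  · rw [eq_div_iff hu.ne']
    have : u ^ 3 * (σ * (σ - y) * (σ - z)) = u ^ 2 * (y * z) := by rw [hsσ] at hsex; linear_combination hsex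
    have hu2 : (u ^ 2 : ℝ) ≠ 0 := pow_ne_zero 2 hu.ne'
    calc σ * (σ - y) * (σ - z) * u = (u ^ 3 * (σ * (σ - y) * (σ - z))) / u ^ 2 := by field_simp
      _ = y * z := by rw [this]; field_simp

/-- ★★ **THE RUNG DENSITY IS ALWAYS BELOW ONE THIRD**: `t(y,z) > 1/3`, i.e. `ρ(y,z) = 1 − 2t(y,z) < 1/3`, for all `y, z > 0`
(`T(σ) > 1/3 ⟺ (y+z)σ > 2yz`, true since `σ > max(y,z) ≥ 2yz/(y+z)`).
[cite: BeatonBousquetMelouDeGierDuminilCopinGuttmann2014, §3.2 Proposition 6 (arXiv v5 p. 10); MadrasSlade1993, §1.1 eq. (1.1.5)] -/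
theorem twoWallRho_lt_one_third (hy : 0 < y) (hz : 0 < z) : twoWallRho y z < 1 / 3 := by
  have h2 := two_mul_totalDensity hy hz
  obtain ⟨ht, hsex, hyσ, hzσ⟩ := totalDensity_ray_eq_scaled hy hz one_pos
  simp only [mul_one] at ht hsex hyσ hzσ
  set σ := stripMuY₂ 1 y z ^ 2 / 1 with hσ
  have hD : 0 < 3 * σ ^ 2 - 2 * (y + z) * σ + y * z := by nlinarith [mul_pos (sub_pos.2 hyσ) (sub_pos.2 hzσ)]
  have hgt : 1 / 3 < σ * (2 * σ - (y + z)) / (2 * (3 * σ ^ 2 - 2 * (y + z) * σ + y * z)) := by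
    rw [div_lt_div_iff₀ (by norm_num) (by positivity)]
    -- `(y+z)σ > 2yz`
    have : 2 * y * z < (y + z) * σ := by nlinarith [mul_pos hy (sub_pos.2 hzσ), mul_pos hz (sub_pos.2 hyσ)]
    nlinarith
  rw [← ht] at hgt
  linarith

/-- The scaled growth parameter blows up for repelling walls: `σ_u = μ_1(yu,zu)²/u → ∞` as `u → 0⁺` (`σ³ ≥ σ(σ−y)(σ−z) = yz/u`).
[cite: BeatonBousquetMelouDeGierDuminilCopinGuttmann2014, §3.2 Proposition 6 (arXiv v5 p. 10) (lane plumbing)] -/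
theorem tendsto_scaledSigma_nhdsGT_zero (hy : 0 < y) (hz : 0 < z) :
    Tendsto (fun u => stripMuY₂ 1 (y * u) (z * u) ^ 2 / u) (𝓝[>] 0) atTop := by
  -- `σ ≥ (yz/u)^{1/3}`: use `σ³ ≥ yz/u` and compare with any bound `M`
  refine tendsto_atTop.2 fun M => ?_
  have hM : 0 < max M 1 := lt_of_lt_of_le one_pos (le_max_right _ _)
  have hev : ∀ᶠ u in 𝓝[>] (0 : ℝ), u < y * z / (max M 1) ^ 3 := by
    have : Set.Ioo (0 : ℝ) (y * z / (max M 1) ^ 3) ∈ 𝓝[>] (0 : ℝ) := Ioo_mem_nhdsGT (by positivity)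
    filter_upwards [this] with u hu using hu.2
  filter_upwards [hev, self_mem_nhdsWithin] with u hu hu0
  have hu0 : (0 : ℝ) < u := hu0
  obtain ⟨-, hsex, hyσ, hzσ⟩ := totalDensity_ray_eq_scaled hy hz hu0
  set σ := stripMuY₂ 1 (y * u) (z * u) ^ 2 / u with hσ
  have hσ0 : 0 < σ := hy.trans hyσ
  -- `σ³ ≥ σ(σ−y)(σ−z) = yz/u > (max M 1)³`
  have h3 : (max M 1) ^ 3 < σ ^ 3 := by
    have hcube : y * z / u = σ * (σ - y) * (σ - z) := hsex.symm
    have hle : σ * (σ - y) * (σ - z) ≤ σ ^ 3 := by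
      have h1 : σ - y ≤ σ := by linarith
      have h2 : σ - z ≤ σ := by linarith
      calc σ * (σ - y) * (σ - z) ≤ σ * σ * σ :=
            mul_le_mul (mul_le_mul_of_nonneg_left h1 hσ0.le) h2 (by linarith) (by positivity)
        _ = σ ^ 3 := by ring
    have hgt : (max M 1) ^ 3 < y * z / u := by
      rw [lt_div_iff₀ hu0]; rw [lt_div_iff₀ (pow_pos hM 3)] at hu; linarith
    linarith
  have : max M 1 < σ := by
    by_contra hle; rw [not_lt] at hle
    have := pow_le_pow_left₀ hσ0.le hle 3
    linarith
  exact (le_max_left M 1).trans this.le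

/-- ★★ **INFINITELY REPELLING WALLS FORCE A RUNG AT EVERY THIRD STEP**: along every ray, `t(yu,zu) → 1/3` and hence the typical rung density
`ρ(yu,zu) → 1/3` as `u → 0⁺` (the supremum `1/3` of `twoWallRho_lt_one_third` is approached: with both walls repelling the walk alternates
surface site – inner site – rung).  [cite: BeatonBousquetMelouDeGierDuminilCopinGuttmann2014, §3.2 Proposition 6 (arXiv v5 p. 10); MadrasSlade1993, §1.1 eq. (1.1.5)] -/
theorem tendsto_twoWallRho_ray_nhdsGT_zero (hy : 0 < y) (hz : 0 < z) :
    Tendsto (fun u => contactB (y * u) (z * u) + contactB (z * u) (y * u)) (𝓝[>] 0) (𝓝 (1 / 3)) ∧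
      Tendsto (fun u => twoWallRho (y * u) (z * u)) (𝓝[>] 0) (𝓝 (1 / 3)) := by
  have hσ := tendsto_scaledSigma_nhdsGT_zero hy hz
  -- `T(σ) = (2 − p/σ)/(2(3 − 2p/σ + q/σ²)) → 2/6 = 1/3`
  have hinv : Tendsto (fun u => (stripMuY₂ 1 (y * u) (z * u) ^ 2 / u)⁻¹) (𝓝[>] 0) (𝓝 0) := tendsto_inv_atTop_zero.comp hσ
  have hT : Tendsto (fun u => (2 - (y + z) * (stripMuY₂ 1 (y * u) (z * u) ^ 2 / u)⁻¹) /
      (2 * (3 - 2 * (y + z) * (stripMuY₂ 1 (y * u) (z * u) ^ 2 / u)⁻¹ + y * z * (stripMuY₂ 1 (y * u) (z * u) ^ 2 / u)⁻¹ ^ 2)))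
      (𝓝[>] 0) (𝓝 ((2 - (y + z) * 0) / (2 * (3 - 2 * (y + z) * 0 + y * z * 0 ^ 2)))) :=
    ((tendsto_const_nhds.sub (hinv.const_mul _)).div
      ((((tendsto_const_nhds.sub (hinv.const_mul _)).add ((hinv.pow 2).const_mul _)).const_mul 2)) (by norm_num))
  have hlim : (2 - (y + z) * 0) / (2 * (3 - 2 * (y + z) * 0 + y * z * 0 ^ 2)) = (1 / 3 : ℝ) := by norm_num
  rw [hlim] at hT
  have ht : Tendsto (fun u => contactB (y * u) (z * u) + contactB (z * u) (y * u)) (𝓝[>] 0) (𝓝 (1 / 3)) := by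
    refine hT.congr' ?_
    filter_upwards [self_mem_nhdsWithin] with u hu
    have hu : (0 : ℝ) < u := hu
    obtain ⟨heq, -, hyσ, -⟩ := totalDensity_ray_eq_scaled hy hz hu
    set σ := stripMuY₂ 1 (y * u) (z * u) ^ 2 / u with hσdef
    have hσ0 : σ ≠ 0 := (hy.trans hyσ).ne'
    rw [heq]
    field_simp
  refine ⟨ht, ?_⟩
  have h := (ht.const_mul 2).const_sub 1
  have e : (1 : ℝ) - 2 * (1 / 3) = 1 / 3 := by norm_num
  rw [e] at h
  refine h.congr' ?_
  filter_upwards [self_mem_nhdsWithin] with u hu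
  have hu : (0 : ℝ) < u := hu
  have := two_mul_totalDensity (mul_pos hy hu) (mul_pos hz hu)
  linarith

/-- ★★ **THE TWO-WALL SPEED ALONG RAYS**: `v(yu,zu) = 2t(yu,zu)` is STRICTLY increasing in `u` and tends to `2/3` as `u → 0⁺` — the lower
bound `2/3 < v(y,z)` of `twoWallSpeed_mem_Ioo` (#555 ed.5) is SHARP: infinitely repelling walls slow the walk to speed `2/3` (a rung at every
third step). [cite: MadrasSlade1993, §1.1 eq. (1.1.5); BeatonBousquetMelouDeGierDuminilCopinGuttmann2014, §3.2 Proposition 6 (arXiv v5 p. 10)] -/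
theorem twoWallSpeed_ray (hy : 0 < y) (hz : 0 < z) :
    (∀ {u u' : ℝ}, 0 < u → u < u' → twoWallSpeed (y * u) (z * u) < twoWallSpeed (y * u') (z * u')) ∧
      Tendsto (fun u => twoWallSpeed (y * u) (z * u)) (𝓝[>] 0) (𝓝 (2 / 3)) := by
  have hv : ∀ {u : ℝ}, 0 < u → twoWallSpeed (y * u) (z * u) = 2 * (contactB (y * u) (z * u) + contactB (z * u) (y * u)) := by
    intro u hu
    have h := contactB_add_contactB_swap (mul_pos hy hu) (mul_pos hz hu)
    linarith
  constructor
  · intro u u' hu huu'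
    rw [hv hu, hv (hu.trans huu')]
    linarith [totalDensity_ray_strictMono hy hz hu huu']
  · have h := ((tendsto_twoWallRho_ray_nhdsGT_zero hy hz).1).const_mul 2
    have e : (2 : ℝ) * (1 / 3) = 2 / 3 := by norm_num
    rw [e] at h
    refine h.congr' ?_
    filter_upwards [self_mem_nhdsWithin] with u hu
    exact (hv hu).symm

/-! ## §6 (ed.3) Infinitely attractive walls along a ray: `ρ(yu,zu) → 0`, `v(yu,zu) → 1` as `u → ∞` -/

/-- `½ − t(y,z) ≤ √((σ−y)(σ−z))/(4σ)` in the scaled variable (`F ≥ σ·((σ−y)+(σ−z)) ≥ 2σ√((σ−y)(σ−z))`): the defect of the total density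
below `½` is controlled by the geometric mean of the two gaps. [cite: BeatonBousquetMelouDeGierDuminilCopinGuttmann2014, §3.2 Proposition 6 (arXiv v5 p. 10) (lane plumbing)] -/
theorem half_sub_totalDensity_ray_le (hy : 0 < y) (hz : 0 < z) {u : ℝ} (hu : 0 < u) :
    0 < 1 / 2 - (contactB (y * u) (z * u) + contactB (z * u) (y * u)) ∧
      1 / 2 - (contactB (y * u) (z * u) + contactB (z * u) (y * u)) ≤
        Real.sqrt ((stripMuY₂ 1 (y * u) (z * u) ^ 2 / u - y) * (stripMuY₂ 1 (y * u) (z * u) ^ 2 / u - z)) /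
          (4 * (stripMuY₂ 1 (y * u) (z * u) ^ 2 / u)) := by
  obtain ⟨ht, -, hyσ, hzσ⟩ := totalDensity_ray_eq_scaled hy hz hu
  set σ := stripMuY₂ 1 (y * u) (z * u) ^ 2 / u with hσ
  have hσ0 : 0 < σ := hy.trans hyσ
  have hA : 0 < σ - y := sub_pos.2 hyσ
  have hB : 0 < σ - z := sub_pos.2 hzσ
  have hD : 0 < 3 * σ ^ 2 - 2 * (y + z) * σ + y * z := by nlinarith [mul_pos hA hB]
  -- `½ − T(σ) = (σ−y)(σ−z)/(2F)`, `F = 3σ² − 2(y+z)σ + yz = (σ−y)(σ−z) + σ(2σ−y−z)`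
  have hdef : 1 / 2 - (contactB (y * u) (z * u) + contactB (z * u) (y * u)) =
      (σ - y) * (σ - z) / (2 * (3 * σ ^ 2 - 2 * (y + z) * σ + y * z)) := by
    rw [ht, eq_div_iff (by positivity), sub_mul, div_mul_cancel₀ _ (by positivity)]
    ring
  rw [hdef]
  refine ⟨by positivity, ?_⟩
  -- AM–GM: `F ≥ σ((σ−y)+(σ−z)) ≥ 2σ√((σ−y)(σ−z))`
  set g := Real.sqrt ((σ - y) * (σ - z)) with hg
  have hg0 : 0 ≤ g := Real.sqrt_nonneg _
  have hg2 : g ^ 2 = (σ - y) * (σ - z) := Real.sq_sqrt (mul_pos hA hB).le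
  have hamgm : 2 * g ≤ (σ - y) + (σ - z) := by
    nlinarith [sq_nonneg (Real.sqrt (σ - y) - Real.sqrt (σ - z)), Real.sq_sqrt hA.le, Real.sq_sqrt hB.le,
      Real.sqrt_mul hA.le (σ - z), hg]
  have hF : 2 * σ * g ≤ 3 * σ ^ 2 - 2 * (y + z) * σ + y * z := by nlinarith [mul_pos hA hB]
  rw [div_le_div_iff₀ (by positivity) (by positivity), ← hg2]
  nlinarith [mul_nonneg hg0 hσ0.le, pow_pos hσ0 2]

/-- The scaled growth parameter tends to `max(y,z)` for infinitely attractive walls: `σ_u → max(y,z)` as `u → ∞`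
(`max(y,z)·(σ − max)² ≤ σ(σ−y)(σ−z) = yz/u`). [cite: BeatonBousquetMelouDeGierDuminilCopinGuttmann2014, §3.2 Proposition 6 (arXiv v5 p. 10) (lane plumbing)] -/
theorem tendsto_scaledSigma_atTop (hy : 0 < y) (hz : 0 < z) :
    Tendsto (fun u => stripMuY₂ 1 (y * u) (z * u) ^ 2 / u) atTop (𝓝 (max y z)) := by
  set m := max y z with hm
  have hm0 : 0 < m := lt_max_of_lt_left hy
  -- squeeze: `m ≤ σ_u ≤ m + √(yz/(m u))`
  have hup : Tendsto (fun u : ℝ => m + Real.sqrt (y * z / (m * u))) atTop (𝓝 m) := by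
    have h1 : Tendsto (fun u : ℝ => y * z / (m * u)) atTop (𝓝 0) := by
      have := tendsto_inv_atTop_zero.comp (tendsto_id.const_mul_atTop hm0)
      have h := this.const_mul (y * z)
      simp only [mul_zero] at h
      refine h.congr fun u => ?_
      simp [div_eq_mul_inv, Function.comp]
    have h2 := (Real.continuous_sqrt.tendsto 0).comp h1
    rw [Real.sqrt_zero] at h2
    simpa using h2.const_add m
  refine tendsto_of_tendsto_of_tendsto_of_le_of_le' tendsto_const_nhds hup ?_ ?_
  · filter_upwards [Filter.eventually_gt_atTop (0 : ℝ)] with u hu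
    obtain ⟨-, -, hyσ, hzσ⟩ := totalDensity_ray_eq_scaled hy hz hu
    exact (max_lt hyσ hzσ).le
  · filter_upwards [Filter.eventually_gt_atTop (0 : ℝ)] with u hu
    obtain ⟨-, hsex, hyσ, hzσ⟩ := totalDensity_ray_eq_scaled hy hz hu
    set σ := stripMuY₂ 1 (y * u) (z * u) ^ 2 / u with hσ
    have hmσ : m < σ := max_lt hyσ hzσ
    have hmin : min y z ≤ m := min_le_max
    -- `m (σ − m)² ≤ σ(σ−y)(σ−z)`: one of the gaps is `σ − m`, the other `≥ σ − m`... use `(σ−y)(σ−z) ≥ (σ−m)²` and `σ ≥ m`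
    have hgap : (σ - m) ^ 2 ≤ (σ - y) * (σ - z) := by
      have h1 : σ - m ≤ σ - y := by linarith [le_max_left y z]
      have h2 : σ - m ≤ σ - z := by linarith [le_max_right y z]
      nlinarith [mul_le_mul h1 h2 (by linarith) (by linarith)]
    have hkey : m * (σ - m) ^ 2 ≤ y * z / u := by
      rw [← hsex]
      calc m * (σ - m) ^ 2 ≤ σ * ((σ - y) * (σ - z)) :=
            mul_le_mul hmσ.le hgap (sq_nonneg _) (by linarith)
        _ = σ * (σ - y) * (σ - z) := by ring
    have hsq : (σ - m) ^ 2 ≤ y * z / (m * u) := by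
      rw [le_div_iff₀ (mul_pos hm0 hu)]
      have := hkey; rw [le_div_iff₀ hu] at this; nlinarith
    have : σ - m ≤ Real.sqrt (y * z / (m * u)) := by
      rw [← Real.sqrt_sq (by linarith : 0 ≤ σ - m)]
      exact Real.sqrt_le_sqrt hsq
    linarith

/-- ★★ **INFINITELY ATTRACTIVE WALLS ALONG A RAY MAKE THE WALK BALLISTIC**: as `u → ∞`, `t(yu,zu) → ½`, the typical rung density
`ρ(yu,zu) → 0` and the two-wall speed `v(yu,zu) → 1` (both surfaces saturate; the upper bound `v < 1` of #555 is sharp along every ray).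
[cite: BeatonBousquetMelouDeGierDuminilCopinGuttmann2014, §3.2 Proposition 6 (arXiv v5 p. 10); MadrasSlade1993, §1.1 eq. (1.1.5)] -/
theorem tendsto_twoWallRho_ray_atTop (hy : 0 < y) (hz : 0 < z) :
    Tendsto (fun u => contactB (y * u) (z * u) + contactB (z * u) (y * u)) atTop (𝓝 (1 / 2)) ∧
      Tendsto (fun u => twoWallRho (y * u) (z * u)) atTop (𝓝 0) ∧
      Tendsto (fun u => twoWallSpeed (y * u) (z * u)) atTop (𝓝 1) := by
  set m := max y z with hm
  have hm0 : 0 < m := lt_max_of_lt_left hy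
  have hσ := tendsto_scaledSigma_atTop hy hz
  -- the bound `√((σ−y)(σ−z))/(4σ) → √((m−y)(m−z))/(4m) = 0`
  have hbound : Tendsto (fun u => Real.sqrt ((stripMuY₂ 1 (y * u) (z * u) ^ 2 / u - y) *
      (stripMuY₂ 1 (y * u) (z * u) ^ 2 / u - z)) / (4 * (stripMuY₂ 1 (y * u) (z * u) ^ 2 / u))) atTop (𝓝 0) := by
    have h1 : Tendsto (fun u => (stripMuY₂ 1 (y * u) (z * u) ^ 2 / u - y) * (stripMuY₂ 1 (y * u) (z * u) ^ 2 / u - z))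
        atTop (𝓝 ((m - y) * (m - z))) := (hσ.sub_const y).mul (hσ.sub_const z)
    have hzero : (m - y) * (m - z) = 0 := by
      rcases le_total y z with h | h
      · rw [hm, max_eq_right h]; ring
      · rw [hm, max_eq_left h]; ring
    rw [hzero] at h1
    have h2 := (Real.continuous_sqrt.tendsto 0).comp h1
    rw [Real.sqrt_zero] at h2
    have h3 := h2.div (hσ.const_mul 4) (by positivity)
    rw [zero_div] at h3
    refine h3.congr fun u => ?_
    simp only [Pi.div_apply, Function.comp_apply]
  have ht : Tendsto (fun u => contactB (y * u) (z * u) + contactB (z * u) (y * u)) atTop (𝓝 (1 / 2)) := by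
    have hdef : Tendsto (fun u => 1 / 2 - (contactB (y * u) (z * u) + contactB (z * u) (y * u))) atTop (𝓝 0) := by
      refine squeeze_zero' ?_ ?_ hbound
      · filter_upwards [Filter.eventually_gt_atTop (0 : ℝ)] with u hu
        exact (half_sub_totalDensity_ray_le hy hz hu).1.le
      · filter_upwards [Filter.eventually_gt_atTop (0 : ℝ)] with u hu
        exact (half_sub_totalDensity_ray_le hy hz hu).2
    have := hdef.const_sub (1 / 2)
    simpa using this
  refine ⟨ht, ?_, ?_⟩
  · have h := (ht.const_mul 2).const_sub 1
    norm_num at h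
    refine h.congr' ?_
    filter_upwards [Filter.eventually_gt_atTop (0 : ℝ)] with u hu
    have := two_mul_totalDensity (mul_pos hy hu) (mul_pos hz hu)
    linarith
  · have h := ht.const_mul 2
    norm_num at h
    refine h.congr' ?_
    filter_upwards [Filter.eventually_gt_atTop (0 : ℝ)] with u hu
    have := contactB_add_contactB_swap (mul_pos hy hu) (mul_pos hz hu)
    linarith

/-! ## §7 (ed.3) Winner takes all: the individual wall densities along a ray -/

/-- The bottom density along a ray is a function of the scaled growth parameter alone: `b(yu,zu) = σ(σ−z)/(2(3σ² − 2(y+z)σ + yz))`,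
`σ = μ_1(yu,zu)²/u` (degree-0 homogeneity of `s(s−z)/F_{y,z}(s)`). [cite: BeatonBousquetMelouDeGierDuminilCopinGuttmann2014, §3.2 Proposition 6 (arXiv v5 p. 10) (lane plumbing)] -/
theorem contactB_ray_eq_scaled (y z : ℝ) {u : ℝ} (hu : 0 < u) :
    contactB (y * u) (z * u) = (stripMuY₂ 1 (y * u) (z * u) ^ 2 / u) * (stripMuY₂ 1 (y * u) (z * u) ^ 2 / u - z) /
      (2 * (3 * (stripMuY₂ 1 (y * u) (z * u) ^ 2 / u) ^ 2 - 2 * (y + z) * (stripMuY₂ 1 (y * u) (z * u) ^ 2 / u) + y * z)) := by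
  unfold contactB sexticDeriv
  set s := stripMuY₂ 1 (y * u) (z * u) ^ 2 with hs
  have hu' : u ≠ 0 := hu.ne'
  have e1 : (s - y * u) * (s - z * u) + s * (s - z * u) + s * (s - y * u) =
      u ^ 2 * (3 * (s / u) ^ 2 - 2 * (y + z) * (s / u) + y * z) := by field_simp; ring
  have e2 : s * (s - z * u) = u ^ 2 * ((s / u) * (s / u - z)) := by field_simp
  rw [e1, e2, mul_left_comm (2 : ℝ), mul_div_mul_left _ _ (pow_ne_zero 2 hu')]

/-- ★★ **STRONGLY REPELLING WALLS SHARE THE RUNGS EVENLY**: as `u → 0⁺`, `b(yu,zu) → 1/6` (and by symmetry `b_top → 1/6`; total `→ ⅓`), whatever the ray.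
[cite: BeatonBousquetMelouDeGierDuminilCopinGuttmann2014, §3.2 Proposition 6 (arXiv v5 p. 10); MadrasSlade1993, §1.2 (elementary)] -/
theorem tendsto_contactB_ray_nhdsGT_zero (hy : 0 < y) (hz : 0 < z) :
    Tendsto (fun u => contactB (y * u) (z * u)) (𝓝[>] 0) (𝓝 (1 / 6)) := by
  have hσ := tendsto_scaledSigma_nhdsGT_zero hy hz
  -- `B(σ) = (1 − z/σ)/(2(3 − 2(y+z)/σ + yz/σ²)) → 1/6`
  have hinv : Tendsto (fun u => (stripMuY₂ 1 (y * u) (z * u) ^ 2 / u)⁻¹) (𝓝[>] 0) (𝓝 0) := tendsto_inv_atTop_zero.comp hσ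
  have hlim : Tendsto (fun u => (1 - z * (stripMuY₂ 1 (y * u) (z * u) ^ 2 / u)⁻¹) /
      (2 * (3 - 2 * (y + z) * (stripMuY₂ 1 (y * u) (z * u) ^ 2 / u)⁻¹ + y * z * (stripMuY₂ 1 (y * u) (z * u) ^ 2 / u)⁻¹ ^ 2)))
      (𝓝[>] 0) (𝓝 ((1 - z * 0) / (2 * (3 - 2 * (y + z) * 0 + y * z * 0 ^ 2)))) :=
    (tendsto_const_nhds.sub (hinv.const_mul z)).div
      ((tendsto_const_nhds.sub (hinv.const_mul _)).add ((hinv.pow 2).const_mul _) |>.const_mul 2) (by norm_num)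
  have e : (1 - z * 0) / (2 * (3 - 2 * (y + z) * 0 + y * z * 0 ^ 2)) = (1 : ℝ) / 6 := by norm_num
  rw [e] at hlim
  refine hlim.congr' ?_
  have hev : ∀ᶠ u in 𝓝[>] (0 : ℝ), 0 < u := eventually_mem_nhdsWithin
  filter_upwards [hev] with u hu
  obtain ⟨-, -, hyσ, -⟩ := totalDensity_ray_eq_scaled hy hz hu
  rw [contactB_ray_eq_scaled y z hu]
  set σ := stripMuY₂ 1 (y * u) (z * u) ^ 2 / u
  have hσ0 : σ ≠ 0 := (hy.trans hyσ).ne'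
  field_simp

/-- ★★ **WINNER TAKES ALL**: along a ray with `y > z`, as `u → ∞` the bottom wall takes every contact — `b(yu,zu) → ½` and `b_top(yu,zu) = b(zu,yu) → 0`
(with §6: the total `→ ½`). On the diagonal `y = z` both tend to `¼` (`b = t/2`).
[cite: BeatonBousquetMelouDeGierDuminilCopinGuttmann2014, §3.2 Proposition 6 (arXiv v5 p. 10); MadrasSlade1993, §1.1 eq. (1.1.5)] -/
theorem tendsto_contactB_ray_atTop (hy : 0 < y) (hz : 0 < z) :
    (z < y → Tendsto (fun u => contactB (y * u) (z * u)) atTop (𝓝 (1 / 2)) ∧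
        Tendsto (fun u => contactB (z * u) (y * u)) atTop (𝓝 0)) ∧
      (y = z → Tendsto (fun u => contactB (y * u) (z * u)) atTop (𝓝 (1 / 4))) := by
  refine ⟨fun hzy => ?_, fun hyz => ?_⟩
  · have hσ := tendsto_scaledSigma_atTop hy hz
    rw [max_eq_left hzy.le] at hσ
    have hF : (3 * y ^ 2 - 2 * (y + z) * y + y * z) = y * (y - z) := by ring
    have hF0 : (2 * (3 * y ^ 2 - 2 * (y + z) * y + y * z)) ≠ 0 := by
      rw [hF]; exact mul_ne_zero two_ne_zero (mul_pos hy (sub_pos.2 hzy)).ne'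
    have hden := ((hσ.pow 2).const_mul 3 |>.sub (hσ.const_mul (2 * (y + z))) |>.add_const (y * z)).const_mul 2
    have hb : Tendsto (fun u => contactB (y * u) (z * u)) atTop (𝓝 (y * (y - z) / (2 * (3 * y ^ 2 - 2 * (y + z) * y + y * z)))) := by
      refine ((hσ.mul (hσ.sub_const z)).div hden hF0).congr' ?_
      filter_upwards [Filter.eventually_gt_atTop (0 : ℝ)] with u hu
      rw [Pi.div_apply, contactB_ray_eq_scaled y z hu]
    have e1 : y * (y - z) / (2 * (3 * y ^ 2 - 2 * (y + z) * y + y * z)) = 1 / 2 := by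
      rw [div_eq_iff hF0]; ring
    rw [e1] at hb
    refine ⟨hb, ?_⟩
    have ht := (tendsto_twoWallRho_ray_atTop hy hz).1
    have h := ht.sub hb
    norm_num at h
    refine h.congr fun u => by ring
  · subst hyz
    have ht := (tendsto_twoWallRho_ray_atTop hy hy).1
    have h := ht.div_const 2
    norm_num at h
    refine h.congr fun u => ?_
    ring

/-! ## §8 (ed.4) Monotonicity of the bottom share along a ray: increasing if `z ≤ y`, decreasing if `z ≥ 2y`, unimodal in between -/

/-- The scaled growth parameter `σ_u = μ_1(yu,zu)²/u` is STRICTLY DECREASING in `u` (the cubic `σ(σ−y)(σ−z) = yz/u` is monotone above `max(y,z)`).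
[cite: BeatonBousquetMelouDeGierDuminilCopinGuttmann2014, §3.2 Proposition 6 (arXiv v5 p. 10) (lane plumbing)] -/
theorem scaledSigma_strictAnti (hy : 0 < y) (hz : 0 < z) {u u' : ℝ} (hu : 0 < u) (huu' : u < u') :
    stripMuY₂ 1 (y * u') (z * u') ^ 2 / u' < stripMuY₂ 1 (y * u) (z * u) ^ 2 / u := by
  have hu' : 0 < u' := hu.trans huu'
  obtain ⟨-, hg, hyσ, hzσ⟩ := totalDensity_ray_eq_scaled hy hz hu
  obtain ⟨-, hg', hyσ', hzσ'⟩ := totalDensity_ray_eq_scaled hy hz hu'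
  by_contra hle
  rw [not_lt] at hle
  have hmono := cubic_mono hyσ.le hzσ.le hle hy.le
  rw [hg, hg'] at hmono
  have : y * z / u' < y * z / u := div_lt_div_of_pos_left (mul_pos hy hz) hu huu'
  linarith

/-- The algebraic heart: for the scaled bottom share `B(σ) = σ(σ−z)/(2F(σ))`, `F(σ) = 3σ² − 2(y+z)σ + yz`,
`B(a) − B(b) = (a − b)·K(a,b)/(2F(a)F(b))` with `K(a,b) = (z − 2y)ab + yz(a + b − z)`.
[cite: BeatonBousquetMelouDeGierDuminilCopinGuttmann2014, §3.2 Proposition 6 (arXiv v5 p. 10) (lane plumbing)] -/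
theorem scaledB_sub (hy : 0 < y) (hz : 0 < z) {a b : ℝ} (hya : y < a) (hza : z < a) (hyb : y < b) (hzb : z < b) :
    a * (a - z) / (2 * (3 * a ^ 2 - 2 * (y + z) * a + y * z)) - b * (b - z) / (2 * (3 * b ^ 2 - 2 * (y + z) * b + y * z)) =
      (a - b) * ((z - 2 * y) * a * b + y * z * (a + b - z)) /
        (2 * (3 * a ^ 2 - 2 * (y + z) * a + y * z) * (3 * b ^ 2 - 2 * (y + z) * b + y * z)) := by
  have hFa : 0 < 3 * a ^ 2 - 2 * (y + z) * a + y * z := by nlinarith [mul_pos (sub_pos.2 hya) (sub_pos.2 hza), hy.trans hya]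
  have hFb : 0 < 3 * b ^ 2 - 2 * (y + z) * b + y * z := by nlinarith [mul_pos (sub_pos.2 hyb) (sub_pos.2 hzb), hy.trans hyb]
  rw [div_sub_div _ _ (by positivity) (by positivity), div_eq_div_iff (by positivity) (by positivity)]
  ring

/-- ★★ **A DOMINANT BOTTOM WALL GAINS SHARE ALL ALONG THE RAY**: if `z ≤ y` then `u ↦ b(yu,zu)` is STRICTLY INCREASING on `(0,∞)` (from `1/6` to `½`, or to `¼`
on the diagonal). [cite: BeatonBousquetMelouDeGierDuminilCopinGuttmann2014, §3.2 Proposition 6 (arXiv v5 p. 10); MadrasSlade1993, §1.2 (elementary)] -/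
theorem contactB_ray_strictMono_of_le (hy : 0 < y) (hz : 0 < z) (hzy : z ≤ y) {u u' : ℝ} (hu : 0 < u) (huu' : u < u') :
    contactB (y * u) (z * u) < contactB (y * u') (z * u') := by
  have hu' : 0 < u' := hu.trans huu'
  obtain ⟨-, -, hyσ, hzσ⟩ := totalDensity_ray_eq_scaled hy hz hu
  obtain ⟨-, -, hyσ', hzσ'⟩ := totalDensity_ray_eq_scaled hy hz hu'
  have hlt := scaledSigma_strictAnti hy hz hu huu'
  rw [contactB_ray_eq_scaled y z hu, contactB_ray_eq_scaled y z hu', ← sub_neg]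
  set a := stripMuY₂ 1 (y * u) (z * u) ^ 2 / u
  set b := stripMuY₂ 1 (y * u') (z * u') ^ 2 / u'
  rw [scaledB_sub hy hz hyσ hzσ hyσ' hzσ']
  have hFa : 0 < 3 * a ^ 2 - 2 * (y + z) * a + y * z := by nlinarith [mul_pos (sub_pos.2 hyσ) (sub_pos.2 hzσ), hy.trans hyσ]
  have hFb : 0 < 3 * b ^ 2 - 2 * (y + z) * b + y * z := by nlinarith [mul_pos (sub_pos.2 hyσ') (sub_pos.2 hzσ'), hy.trans hyσ']
  -- `K(a,b) < 0` for `a, b > y ≥ z`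
  have hK : (z - 2 * y) * a * b + y * z * (a + b - z) < 0 := by
    nlinarith [mul_pos (sub_pos.2 hyσ) (sub_pos.2 hyσ'), mul_pos hy (sub_pos.2 hyσ), mul_pos hy (sub_pos.2 hyσ'),
      mul_nonneg (sub_nonneg.2 hzy) (sub_pos.2 hyσ).le, mul_nonneg (sub_nonneg.2 hzy) hy.le]
  exact div_neg_of_neg_of_pos (mul_neg_of_pos_of_neg (sub_pos.2 hlt) hK) (by positivity)

/-- ★★ **A STRONGLY DOMINATED BOTTOM WALL LOSES SHARE ALL ALONG THE RAY**: if `2y ≤ z` then `u ↦ b(yu,zu)` is STRICTLY DECREASING on `(0,∞)` (from `1/6` to `0`).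
[cite: BeatonBousquetMelouDeGierDuminilCopinGuttmann2014, §3.2 Proposition 6 (arXiv v5 p. 10); MadrasSlade1993, §1.2 (elementary)] -/
theorem contactB_ray_strictAnti_of_le (hy : 0 < y) (hz : 0 < z) (h2 : 2 * y ≤ z) {u u' : ℝ} (hu : 0 < u) (huu' : u < u') :
    contactB (y * u') (z * u') < contactB (y * u) (z * u) := by
  have hu' : 0 < u' := hu.trans huu'
  obtain ⟨-, -, hyσ, hzσ⟩ := totalDensity_ray_eq_scaled hy hz hu
  obtain ⟨-, -, hyσ', hzσ'⟩ := totalDensity_ray_eq_scaled hy hz hu'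
  have hlt := scaledSigma_strictAnti hy hz hu huu'
  rw [contactB_ray_eq_scaled y z hu, contactB_ray_eq_scaled y z hu', ← sub_pos]
  set a := stripMuY₂ 1 (y * u) (z * u) ^ 2 / u
  set b := stripMuY₂ 1 (y * u') (z * u') ^ 2 / u'
  rw [scaledB_sub hy hz hyσ hzσ hyσ' hzσ']
  have hFa : 0 < 3 * a ^ 2 - 2 * (y + z) * a + y * z := by nlinarith [mul_pos (sub_pos.2 hyσ) (sub_pos.2 hzσ), hy.trans hyσ]
  have hFb : 0 < 3 * b ^ 2 - 2 * (y + z) * b + y * z := by nlinarith [mul_pos (sub_pos.2 hyσ') (sub_pos.2 hzσ'), hy.trans hyσ']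
  -- `K(a,b) > 0` for `a, b > z ≥ 2y`
  have hK : 0 < (z - 2 * y) * a * b + y * z * (a + b - z) := by
    nlinarith [mul_nonneg (sub_nonneg.2 h2) (mul_pos (hz.trans hzσ) (hz.trans hzσ')).le, mul_pos hy hz, sub_pos.2 hzσ, hz.trans hzσ']
  exact div_pos (mul_pos (sub_pos.2 hlt) hK) (by positivity)

/-- ★★ **THE UNIMODAL REGIME `y < z < 2y`**: with `k(σ) = (z − 2y)σ² + 2yzσ − yz²` (a downward parabola, positive at `σ = z`, with a unique zero
`σ₀ = z(y + √(y(z−y)))/(2y − z)` above `z`), the bottom share `u ↦ b(yu,zu)` is strictly INCREASING while `k(σ_u) ≤ 0` (small `u`: `σ_u ≥ σ₀`)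
and strictly DECREASING once `k(σ_u) ≥ 0` (large `u`: `σ_u ≤ σ₀`): it rises from `1/6` ABOVE its limit and falls back to `0`.
[cite: BeatonBousquetMelouDeGierDuminilCopinGuttmann2014, §3.2 Proposition 6 (arXiv v5 p. 10); MadrasSlade1993, §1.2 (elementary)] -/
theorem contactB_ray_unimodal (hy : 0 < y) (hz : 0 < z) (hyz : y < z) (hz2 : z < 2 * y) {u u' : ℝ} (hu : 0 < u) (huu' : u < u') :
    ((z - 2 * y) * (stripMuY₂ 1 (y * u') (z * u') ^ 2 / u') ^ 2 + 2 * y * z * (stripMuY₂ 1 (y * u') (z * u') ^ 2 / u') - y * z ^ 2 ≤ 0 →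
        contactB (y * u) (z * u) < contactB (y * u') (z * u')) ∧
      (0 ≤ (z - 2 * y) * (stripMuY₂ 1 (y * u) (z * u) ^ 2 / u) ^ 2 + 2 * y * z * (stripMuY₂ 1 (y * u) (z * u) ^ 2 / u) - y * z ^ 2 →
        contactB (y * u') (z * u') < contactB (y * u) (z * u)) := by
  have hu' : 0 < u' := hu.trans huu'
  obtain ⟨-, -, hyσ, hzσ⟩ := totalDensity_ray_eq_scaled hy hz hu
  obtain ⟨-, -, hyσ', hzσ'⟩ := totalDensity_ray_eq_scaled hy hz hu'
  have hlt := scaledSigma_strictAnti hy hz hu huu'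
  rw [contactB_ray_eq_scaled y z hu, contactB_ray_eq_scaled y z hu']
  set a := stripMuY₂ 1 (y * u) (z * u) ^ 2 / u
  set b := stripMuY₂ 1 (y * u') (z * u') ^ 2 / u'
  have hFa : 0 < 3 * a ^ 2 - 2 * (y + z) * a + y * z := by nlinarith [mul_pos (sub_pos.2 hyσ) (sub_pos.2 hzσ), hy.trans hyσ]
  have hFb : 0 < 3 * b ^ 2 - 2 * (y + z) * b + y * z := by nlinarith [mul_pos (sub_pos.2 hyσ') (sub_pos.2 hzσ'), hy.trans hyσ']
  have h2yz : 0 < 2 * y - z := by linarith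
  -- `σ* = yz/(2y−z)`: the slope of `K` in each variable is `(z−2y)·other + yz`, negative iff `other > σ*`; `k > 0` on `(z, σ*]`
  have hkpos : ∀ {c : ℝ}, z < c → c * (2 * y - z) ≤ y * z → 0 < (z - 2 * y) * c ^ 2 + 2 * y * z * c - y * z ^ 2 := by
    intro c hzc hc
    -- `k(c) = c·[yz − (2y−z)c] + yz(c − z)`, first bracket `≥ 0`, second term `> 0`
    nlinarith [mul_nonneg (hz.trans hzc).le (sub_nonneg.2 hc), mul_pos (mul_pos hy hz) (sub_pos.2 hzc)]
  refine ⟨fun hkb => ?_, fun hka => ?_⟩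
  · -- `b ≥ σ₀ > σ*` hence slopes negative and `K(a,b) < k(b) ≤ 0`
    have hbstar : y * z < b * (2 * y - z) := by
      by_contra h
      exact absurd hkb (not_le.2 (hkpos hzσ' (not_lt.1 h)))
    rw [← sub_neg, scaledB_sub hy hz hyσ hzσ hyσ' hzσ']
    have hK : (z - 2 * y) * a * b + y * z * (a + b - z) < 0 := by
      have e : (z - 2 * y) * a * b + y * z * (a + b - z) =
          ((z - 2 * y) * b ^ 2 + 2 * y * z * b - y * z ^ 2) - (a - b) * (b * (2 * y - z) - y * z) := by ring
      rw [e]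
      nlinarith [mul_pos (sub_pos.2 hlt) (sub_pos.2 hbstar)]
    exact div_neg_of_neg_of_pos (mul_neg_of_pos_of_neg (sub_pos.2 hlt) hK) (by positivity)
  · -- `a ≤ σ₀`: `K(a,b) > 0` for `z < b < a ≤ σ₀`
    rw [← sub_pos, scaledB_sub hy hz hyσ hzσ hyσ' hzσ']
    have hK : 0 < (z - 2 * y) * a * b + y * z * (a + b - z) := by
      rcases le_or_gt (b * (2 * y - z)) (y * z) with hb | hb
      · -- slope in `a` is `yz − (2y−z)b ≥ 0`: `K(a,b) ≥ K(z,b) = zb(z−y) > 0`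
        have e : (z - 2 * y) * a * b + y * z * (a + b - z) = z * b * (z - y) + (a - z) * (y * z - b * (2 * y - z)) := by ring
        rw [e]
        nlinarith [mul_pos (mul_pos hz (hz.trans hzσ')) (sub_pos.2 hyz), mul_nonneg (sub_pos.2 hzσ).le (sub_nonneg.2 hb)]
      · -- slope in `a` negative: `K(a,b) ≥ K(a,a)|` via `K(a,b) = k(a) + (a − b)(b(2y−z) − yz)·(-1)`... use `K(a,b) = k(a) − (a−b)((2y−z)a − yz)`? both `a,b > σ*`
        have e : (z - 2 * y) * a * b + y * z * (a + b - z) =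
            ((z - 2 * y) * a ^ 2 + 2 * y * z * a - y * z ^ 2) + (a - b) * (a * (2 * y - z) - y * z) := by ring
        rw [e]
        have hastar : y * z < a * (2 * y - z) := lt_trans hb (by nlinarith [sub_pos.2 hlt])
        nlinarith [mul_pos (sub_pos.2 hlt) (sub_pos.2 hastar)]
    exact div_pos (mul_pos (sub_pos.2 hlt) hK) (by positivity)

end Literature.Probability.RandomPlanarGeometry.SAW.HexBW
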